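import Literature.NumberTheory.Sieve.MatomakiRadziwillProp1U2
import HarnessLib

/-!
# Matomäki–Radziwiłł 2016, Proposition 1 — part (d3): the large values and the bound for `∫_𝒰` (§8.3)

Topic `NumberTheory/Sieve`; sixth file of the assembly of `MatomakiRadziwill2016_prop1` (Proposition 1 of
K. Matomäki, M. Radziwiłł, *Multiplicative functions in short intervals*, Ann. of Math. 183 (2016), §8),
after `…Prop1Partition` (a), `…Prop1E1` (b), `…Prop1Ej` (c), `…Prop1U1` (d1), `…Prop1U2` (d2).
Everything is proved; there are no new definitions.

§8.3 of the paper, after the discretisation `∫_𝒰 |Q_{v,H} R_{v,H}|² ≤ 2 ∑_{t ∈ 𝒯} |Q_{v,H} R_{v,H}|²(t)` and the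
count of `𝒯` (file (d2)), splits `𝒯 = 𝒯_S ∪ 𝒯_L` according to `|Q_{v,H}(1+it)| < (log X)^{-100}` or not:
"By Lemma 9, `∑_{t ∈ 𝒯_S} … ≪ (log X)^{-199}` … By Lemma 8, `|𝒯_L| ≪ exp((log X)^{1/48+o(1)})`, and by
Lemmas 3 and 5 (since `2^J ≪ (log X)^{o(1)}`), `max |R_{v,H}(1+iu)| ≪ (log X)^{-1/16+o(1)} log Q/log P`.
Thus by Lemma 11 … `∑_{t ∈ 𝒯_L} |R_{v,H}|² |Q_{v,H}|² ≪ (log X)^{-1/8+o(1)} (log Q)²/(log P)⁴ · 1/H` …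
Combining the above estimates, `∫_𝒰 |F(1+it)|² dt ≪ (T/X + 1)(log X)^{-1/48+o(1)}`."

This file makes that explicit, with the parameters `H = L^{1/50}`, `P = exp(L^{97/100})`, `Q = exp(L^{99/100})`
(`L = log X`; the paper's `(log X)^{1/48}`, `exp((log X)^{47/48})`, `exp(log X/log log X)` are replaced by pure
powers, which moves the exponent bookkeeping from `L^{-1/48+o(1)}` to `L^{-1/40} · 4^J` for the `𝒯_L`-term and
`L^{-1/50}` for the `1/H` and sieve terms — see `main_numeric`), in the range `X^{1/4} ≤ T ≤ X` (smaller `T` are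
treated by monotonicity and larger ones by the trivial bound in the final assembly) and under explicit,
constant-free size conditions `c2`–`c7` on `L` (all eventually true; discharged in the final assembly):

* `MatomakiRadziwillU.card_primes_block_le` — Brun–Titchmarsh (`card_primes_Ioc_le`, hypothesis `hBT`) for one
  prime block: `#{p prime : e^{v/H} ≤ p < e^{(v+1)/H}} ≤ 6 C e^{v/H}/(H · v/H)` when `e^{v/H} ≥ 4H²`;
* `MatomakiRadziwillU.TL_card_le` — `#𝒯_L ≤ C₈ L^{200} exp(408 L^{3/100} log L)` (Lemma 8, sharp form, with
  `V = L^{100}`, `log P' = v/H ≥ L^{97/100}/2`, `log T ≤ L`);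
* `MatomakiRadziwillU.TL_sum_sq_le` — Lemma 11 (`ε = 1/10`, hypothesis `h11`) on `𝒯_L`:
  `∑_{t ∈ 𝒯_L} |Q_{v,H}(1+it)|² ≤ 24 C₁₁ C (1+C₈)/(H (L^{97/100})²)` (the count of `𝒯_L` kills the second
  term of Lemma 11 under `c6`; the block is short by Brun–Titchmarsh);
* `SieveIntervalSystem.norm_blockCofactorPoly_le` — Lemma 5 (`sum_filter_mem_eq`) inside `R_{v,H}` and
  Lemma 3 (`A = 2`, hypothesis `h3`) for the `2^J` multiplicative functions `f g_𝒥` at `X' = X e^{-v/H}`: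
  `|R_{v,H}(1+it)| ≤ 2^J · 3C₃ L^{1/50-1/16}` for `(log X)^{1/15} ≤ t ≤ T ≤ X`;
* `SieveIntervalSystem.TS_sum_le` — Lemma 9 on `𝒯_S`: `∑_{𝒯_S} |Q R|² ≤ 2C₉(4 + 4^20 C₈) L · L^{-200}`, using
  the point count of file (d2) and `#ℐ_J ≤ 2·4^19 L^{1/14} e^{√L/6} √L` (`card_blocks_J_le`);
* `SieveIntervalSystem.sum_block_le`, `sum_blocks_integral_le` — one block, all blocks;
* `SieveIntervalSystem.integral_Uset_bound` — **the bound for `∫_𝒰 |F(1+it)|² dt`**: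
  `≤ (T/X + 1) 20000 (2 + K(2e⁶+1)) L^{-1/50} + 160000 C₉ (4 + 4^20 C₈) L^{-1/50}
   + 17280000 C₃² C₁₁ C (1+C₈) 4^J L^{-1/40}`
  (second application of Lemma 12 from file (d1), the blocks above, and the sieve term
  `card_Icc_filter_forall_not_dvd_le`, hypothesis `hK`).

The hypotheses "Lemma n holds with constant `C`" (`h3`, `h8`, `h9`, `h11`) are the bodies of the corresponding
facts/lemmas written out (Lemmas 8♯ and 9 are proved in the tree, Lemmas 3 and 11 are named facts; the final
assembly instantiates them).

## References

* K. Matomäki, M. Radziwiłł, *Multiplicative functions in short intervals*, Ann. of Math. (2) 183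
  (2016), 1015–1056, doi:10.4007/annals.2016.183.3.6, arXiv:1501.04585: §8.3 (arXiv pp. 17–18), Lemmas 3, 5,
  8, 9, 11.
-/

noncomputable section

open Finset Complex MeasureTheory

namespace Literature.NumberTheory.Sieve

namespace MatomakiRadziwillU

/-! ### Brun–Titchmarsh for one prime block `[e^{v/H}, e^{(v+1)/H})` -/

/-- **The prime block is short** ("since we are looking at primes in a short interval", §8.3): for `H ≥ 1` and
`P = e^{v/H} ≥ 4H²`, the number of primes `p` with `e^{v/H} ≤ p < e^{(v+1)/H}` (inside any `[P', Q']`) is at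
most `6 C P/(H log P)`, `C` the Brun–Titchmarsh constant of `card_primes_Ioc_le` (hypothesis `hBT`): the block
has length `≤ P(e^{1/H} - 1) + 1 ≤ 3P/H` and `log(3P/H) ≥ (log P)/2`. [cite: MatomakiRadziwillAnnals2016, §8.3] -/
theorem card_primes_block_le {C : ℝ} (hC : 0 ≤ C)
    (hBT : ∀ N M : ℕ, 2 ≤ M → (#((Ioc N (N + M)).filter Nat.Prime) : ℝ) ≤ C * M / Real.log M)
    (P' Q' : ℝ) {H : ℝ} (hH : 1 ≤ H) (v : ℕ) (hP : 4 * H ^ 2 ≤ Real.exp (v / H)) :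
    (#(((Icc ⌈P'⌉₊ ⌊Q'⌋₊).filter Nat.Prime).filter
        (fun p : ℕ => Real.exp (v / H) ≤ p ∧ (p : ℝ) < Real.exp ((v + 1) / H))) : ℝ) ≤
      6 * C * Real.exp (v / H) / (H * (v / H)) := by
  set P : ℝ := Real.exp (v / H) with hPdef
  have hP0 : 0 < P := Real.exp_pos _
  have hH0 : 0 < H := by linarith
  have hPH : 4 * H ≤ P := le_trans (by nlinarith) hP
  have hexp : Real.exp (((v : ℝ) + 1) / H) = P * Real.exp (1 / H) := by
    rw [hPdef, ← Real.exp_add]; congr 1; ring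
  -- the block sits inside `Ioc N (N + M)`, `N = ⌈P⌉ - 1`, `N + M = ⌊P e^{1/H}⌋`
  set N : ℕ := ⌈P⌉₊ - 1 with hN
  have hceil : 1 ≤ ⌈P⌉₊ := Nat.one_le_iff_ne_zero.2 (Nat.ceil_pos.2 hP0).ne'
  have hPe : P ≤ P * Real.exp (1 / H) := le_mul_of_one_le_right hP0.le (Real.one_le_exp (by positivity))
  have hNM : ⌈P⌉₊ ≤ ⌊P * Real.exp (1 / H)⌋₊ + 1 := by
    have : ⌈P⌉₊ ≤ ⌊P⌋₊ + 1 := Nat.ceil_le_floor_add_one P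
    exact this.trans (by gcongr)
  set M : ℕ := ⌊P * Real.exp (1 / H)⌋₊ + 1 - ⌈P⌉₊ with hM
  have hNMeq : N + M = ⌊P * Real.exp (1 / H)⌋₊ := by omega
  have hsub : ((Icc ⌈P'⌉₊ ⌊Q'⌋₊).filter Nat.Prime).filter
      (fun p : ℕ => Real.exp (v / H) ≤ p ∧ (p : ℝ) < Real.exp ((v + 1) / H)) ⊆
      (Ioc N (N + M)).filter Nat.Prime := by
    intro p hp
    rw [mem_filter] at hp ⊢
    rw [mem_filter] at hp
    refine ⟨mem_Ioc.2 ⟨?_, ?_⟩, hp.1.2⟩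
    · have : ⌈P⌉₊ ≤ p := Nat.ceil_le.2 hp.2.1
      omega
    · rw [hNMeq]
      refine Nat.le_floor ?_
      rw [← hexp]; exact hp.2.2.le
  -- the size of `M`: `P/H - 1 ≤ M ≤ 3P/H`
  have he1 : Real.exp (1 / H) - 1 ≤ 2 / H := by
    have hy : |1 / H| ≤ 1 := by rw [abs_of_pos (by positivity)]; exact (div_le_one hH0).2 hH
    have := Real.abs_exp_sub_one_sub_id_le hy
    have h2 : (1 / H) ^ 2 ≤ 1 / H := by
      rw [sq]; exact mul_le_of_le_one_left (by positivity) ((div_le_one hH0).2 hH)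
    have h3 := (abs_le.1 this).2
    have h4 : (2 : ℝ) / H = 1 / H + 1 / H := by ring
    linarith
  have he2 : 1 / H ≤ Real.exp (1 / H) - 1 := by linarith [Real.add_one_le_exp (1 / H)]
  have hMre : (M : ℝ) = (⌊P * Real.exp (1 / H)⌋₊ : ℝ) + 1 - ⌈P⌉₊ := by
    rw [hM, Nat.cast_sub hNM]; push_cast; ring
  have hMup : (M : ℝ) ≤ 3 * P / H := by
    rw [hMre]
    have h1 : (⌊P * Real.exp (1 / H)⌋₊ : ℝ) ≤ P * Real.exp (1 / H) := Nat.floor_le (by positivity)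
    have h2 : P ≤ ⌈P⌉₊ := Nat.le_ceil P
    have h3 : P * Real.exp (1 / H) + 1 - P = P * (Real.exp (1 / H) - 1) + 1 := by ring
    have h4 : P * (Real.exp (1 / H) - 1) ≤ P * (2 / H) := mul_le_mul_of_nonneg_left he1 hP0.le
    have h5 : (1 : ℝ) ≤ P / H := by rw [le_div_iff₀ hH0]; linarith
    calc (⌊P * Real.exp (1 / H)⌋₊ : ℝ) + 1 - ⌈P⌉₊ ≤ P * Real.exp (1 / H) + 1 - P := by linarith
      _ ≤ P * (2 / H) + P / H := by linarith
      _ = 3 * P / H := by ring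
  have hMlo : P / H - 1 ≤ (M : ℝ) := by
    rw [hMre]
    have h1 : P * Real.exp (1 / H) - 1 ≤ (⌊P * Real.exp (1 / H)⌋₊ : ℝ) :=
      (Nat.sub_one_lt_floor _).le
    have h2 : (⌈P⌉₊ : ℝ) < P + 1 := Nat.ceil_lt_add_one hP0.le
    have h4 : P * (1 / H) ≤ P * (Real.exp (1 / H) - 1) := mul_le_mul_of_nonneg_left he2 hP0.le
    have : P / H = P * (1 / H) := by ring
    linarith
  have hM3 : (3 : ℝ) ≤ M := by
    have : (4 : ℝ) ≤ P / H := by rw [le_div_iff₀ hH0]; linarith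
    linarith
  have hM2 : 2 ≤ M := by exact_mod_cast (show (2 : ℝ) ≤ M by linarith)
  have hMe : Real.exp 1 ≤ M := le_trans Real.exp_one_lt_three.le hM3
  -- Brun–Titchmarsh and the monotonicity of `x/log x`
  have h1 := hBT N M hM2
  -- `x/log x` is monotone on `[e, ∞)` (as `BFI.div_log_mono` in `BombieriFriedlanderIwaniecCaseTools.lean`, not imported)
  have h2 : (M : ℝ) / Real.log M ≤ (3 * P / H) / Real.log (3 * P / H) := by
    have ha0 : (0 : ℝ) < M := (Real.exp_pos 1).trans_le hMe
    have hb0 : (0 : ℝ) < 3 * P / H := ha0.trans_le hMup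
    have hla : 1 ≤ Real.log M := by rw [← Real.log_exp 1]; exact Real.log_le_log (Real.exp_pos 1) hMe
    have hlb : 1 ≤ Real.log (3 * P / H) := hla.trans (Real.log_le_log ha0 hMup)
    have h := Real.log_div_self_antitoneOn (Set.mem_setOf.2 hMe) (Set.mem_setOf.2 (hMe.trans hMup)) hMup
    have e1 : (M : ℝ) / Real.log M = 1 / (Real.log M / M) := by field_simp
    have e2 : (3 * P / H) / Real.log (3 * P / H) = 1 / (Real.log (3 * P / H) / (3 * P / H)) := by field_simp
    rw [e1, e2]
    exact one_div_le_one_div_of_le (div_pos (by linarith only [hlb]) hb0) h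
  -- `log(3P/H) ≥ (log P)/2 = (v/H)/2`
  have hlogP : Real.log P = v / H := by rw [hPdef, Real.log_exp]
  have hvH : 0 ≤ (v : ℝ) / H := by positivity
  have hH2P : H ^ 2 ≤ P := by nlinarith
  have hlog3 : (v / H) / 2 ≤ Real.log (3 * P / H) := by
    have hlogH : 2 * Real.log H ≤ Real.log P := by
      rw [← Real.log_rpow hH0, show H ^ (2 : ℝ) = H ^ 2 by norm_cast]
      exact Real.log_le_log (by positivity) hH2P
    have : Real.log (3 * P / H) = Real.log 3 + Real.log P - Real.log H := by
      rw [Real.log_div (by positivity) hH0.ne', Real.log_mul (by norm_num) hP0.ne']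
    rw [this, hlogP]
    have hlog3' : 0 ≤ Real.log 3 := Real.log_nonneg (by norm_num)
    rw [hlogP] at hlogH
    linarith
  have hM0 : (0 : ℝ) < M := by linarith
  have hlogM : 0 < Real.log M := Real.log_pos (by linarith)
  rcases eq_or_lt_of_le hvH with hv0 | hv0
  · -- `v = 0`: then `P = 1 < 4H²`, impossible
    exfalso
    have : P = 1 := by rw [hPdef, ← hv0, Real.exp_zero]
    nlinarith
  have hb0 : 0 < 3 * P / H := by positivity
  calc (#(((Icc ⌈P'⌉₊ ⌊Q'⌋₊).filter Nat.Prime).filter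
        (fun p : ℕ => Real.exp (v / H) ≤ p ∧ (p : ℝ) < Real.exp ((v + 1) / H))) : ℝ)
      ≤ #((Ioc N (N + M)).filter Nat.Prime) := by exact_mod_cast card_le_card hsub
    _ ≤ C * M / Real.log M := h1
    _ = C * (M / Real.log M) := by ring
    _ ≤ C * ((3 * P / H) / Real.log (3 * P / H)) := mul_le_mul_of_nonneg_left h2 hC
    _ ≤ C * ((3 * P / H) / ((v / H) / 2)) := by
        refine mul_le_mul_of_nonneg_left (div_le_div_of_nonneg_left hb0.le (by positivity) hlog3) hC
    _ = 6 * C * P / (H * (v / H)) := by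
        field_simp
        ring

/-! ### The parameters `H = (log X)^{1/50}`, `P = exp((log X)^{97/100})`, `Q = exp((log X)^{99/100})` -/

/-- Consequences of the size conditions `2 ≤ L^{1/50}` and `40 L^{99/100} ≤ L` on `L = log X ≥ 1`:
`L ≥ 400`, `L^{1/100} ≥ 40`, `L = L^{99/100} L^{1/100} = L^{97/100} L^{3/100}`, `40 ≤ L^{97/100} ≤ L^{99/100}`.
[folklore] -/
theorem Lfacts {L : ℝ} (hL1 : 1 ≤ L) (c2 : 2 ≤ L ^ (1 / 50 : ℝ)) (c3 : 40 * L ^ (99 / 100 : ℝ) ≤ L) :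
    400 ≤ L ∧ 40 ≤ L ^ (1 / 100 : ℝ) ∧ L = L ^ (99 / 100 : ℝ) * L ^ (1 / 100 : ℝ) ∧
      L = L ^ (97 / 100 : ℝ) * L ^ (3 / 100 : ℝ) ∧ 40 ≤ L ^ (97 / 100 : ℝ) ∧
      L ^ (97 / 100 : ℝ) ≤ L ^ (99 / 100 : ℝ) := by
  have hL0 : 0 < L := by linarith
  have h1 : L = L ^ (99 / 100 : ℝ) * L ^ (1 / 100 : ℝ) := by
    rw [← Real.rpow_add hL0]; norm_num
  have h2 : L = L ^ (97 / 100 : ℝ) * L ^ (3 / 100 : ℝ) := by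
    rw [← Real.rpow_add hL0]; norm_num
  have h400 : 400 ≤ L := by
    have h : (L ^ (1 / 50 : ℝ)) ^ (50 : ℕ) = L := by
      rw [← Real.rpow_natCast, ← Real.rpow_mul hL0.le]; norm_num
    have h' : (2 : ℝ) ^ (50 : ℕ) ≤ (L ^ (1 / 50 : ℝ)) ^ (50 : ℕ) := pow_le_pow_left₀ (by norm_num) c2 50
    rw [h] at h'
    have : (400 : ℝ) ≤ (2 : ℝ) ^ (50 : ℕ) := by norm_num
    linarith
  have h99 : 0 < L ^ (99 / 100 : ℝ) := Real.rpow_pos_of_pos hL0 _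
  have h40 : 40 ≤ L ^ (1 / 100 : ℝ) := by
    by_contra h
    push Not at h
    have : L ^ (99 / 100 : ℝ) * L ^ (1 / 100 : ℝ) < L ^ (99 / 100 : ℝ) * 40 := mul_lt_mul_of_pos_left h h99
    linarith
  have h97 : 40 ≤ L ^ (97 / 100 : ℝ) :=
    h40.trans (Real.rpow_le_rpow_of_exponent_le hL1 (by norm_num))
  exact ⟨h400, h40, h1, h2, h97, Real.rpow_le_rpow_of_exponent_le hL1 (by norm_num)⟩

/-- The range of `x = v/H` for `v ∈ [⌊H A⌋, ⌊H B⌋]`: `A - 1/H < x ≤ B` (`H > 0`, `B ≥ 0`). [folklore] -/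
theorem div_mem_of_mem_Icc {H A B : ℝ} (hH : 0 < H) (hB : 0 ≤ B) {v : ℕ} (hv : v ∈ Icc ⌊H * A⌋₊ ⌊H * B⌋₊) :
    A - 1 / H < v / H ∧ (v : ℝ) / H ≤ B := by
  rw [mem_Icc] at hv
  constructor
  · have h1 : H * A - 1 < v := by
      have := Nat.sub_one_lt_floor (H * A)
      have h2 : ((⌊H * A⌋₊ : ℕ) : ℝ) ≤ v := by exact_mod_cast hv.1
      linarith
    rw [lt_div_iff₀ hH]
    have : (A - 1 / H) * H = H * A - 1 := by field_simp
    linarith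
  · rw [div_le_iff₀ hH]
    have h2 : (v : ℝ) ≤ ((⌊H * B⌋₊ : ℕ) : ℝ) := by exact_mod_cast hv.2
    have h3 : ((⌊H * B⌋₊ : ℕ) : ℝ) ≤ H * B := Nat.floor_le (by positivity)
    linarith

/-! ### The large values `𝒯_L`: their number (Lemma 8) -/

set_option maxHeartbeats 400000 in
/-- **`|𝒯_L|` is small** (§8.3: "By Lemma 8, `|𝒯_L| ≪ exp(2 (log(log X)^{100})/(v/H) log T + 2 log(log X)^{100}
+ 2 (log T)/(v/H) log log T) ≪ exp((log X)^{1+o(1)}/log P)`"), explicitly: for `X^{1/4} ≤ T ≤ X`, `L = log X`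
with `2 ≤ L^{1/50}`, `40 L^{99/100} ≤ L`, a `1`-spaced `𝒯 ⊂ [T₀, T]` (`T₀ ≥ 0`) and a block index
`v ∈ [⌊H log P⌋, H log Q]`, the points with `|Q_{v,H}(1+it)| ≥ L^{-100}` number at most
`C₈ L^{200} exp(408 L^{3/100} log L)` (Lemma 8 with `V = L^{100}`, `log P' = v/H ≥ L^{97/100}/2`, `log T ≤ L`).
[cite: MatomakiRadziwillAnnals2016, §8.3] -/
theorem TL_card_le {X : ℝ} {C₈ : ℝ} (hC₈ : 0 ≤ C₈) (h8 : (∀ (P T V : ℝ) (a : ℕ → ℂ) (𝒯 : Finset ℝ), 2 ≤ P → P ^ 2 ≤ T →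
      Real.exp (Real.exp 4) ≤ T → 1 ≤ V → (∀ p, ‖a p‖ ≤ 1) → (∀ t ∈ 𝒯, |t| ≤ T) →
      (∀ t ∈ 𝒯, ∀ t' ∈ 𝒯, t ≠ t' → 1 ≤ |t - t'|) →
      (∀ t ∈ 𝒯, V⁻¹ ≤ ‖∑ p ∈ (Finset.Icc ⌈P⌉₊ ⌊2 * P⌋₊).filter Nat.Prime,
          a p * (p : ℂ) ^ (-(1 + (t : ℂ) * Complex.I))‖) →
      ((Finset.card 𝒯 : ℕ) : ℝ) ≤ C₈ * V ^ 2 * T ^ (2 * Real.log V / Real.log P)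
        * Real.exp (4 * (Real.log T / Real.log P) * Real.log (Real.log T)))) {c : ℕ → ℂ}
    (hc : ∀ p, ‖c p‖ ≤ 1) (hXe : Real.exp 1 ≤ X) (c2 : 2 ≤ Real.log X ^ (1 / 50 : ℝ))
    (c3 : 40 * Real.log X ^ (99 / 100 : ℝ) ≤ Real.log X) {T₀ T : ℝ} (hT₀ : 0 ≤ T₀)
    (hXT : X ^ (1 / 4 : ℝ) ≤ T) (hTX : T ≤ X) {v : ℕ}
    (hv : v ∈ Icc ⌊Real.log X ^ (1 / 50 : ℝ) * Real.log (Real.exp (Real.log X ^ (97 / 100 : ℝ)))⌋₊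
      ⌊Real.log X ^ (1 / 50 : ℝ) * Real.log (Real.exp (Real.log X ^ (99 / 100 : ℝ)))⌋₊)
    (𝒯 : Finset ℝ) (h𝒯 : ∀ t ∈ 𝒯, t ∈ Set.Icc T₀ T) (hws : ∀ t ∈ 𝒯, ∀ t' ∈ 𝒯, t ≠ t' → 1 ≤ |t - t'|) :
    (#(𝒯.filter fun t => (Real.log X ^ 100)⁻¹ ≤
        ‖blockPrimePoly c (Real.exp (Real.log X ^ (97 / 100 : ℝ))) (Real.exp (Real.log X ^ (99 / 100 : ℝ)))
          (Real.log X ^ (1 / 50 : ℝ)) v t‖) : ℝ) ≤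
      C₈ * (Real.log X ^ 100) ^ 2 * Real.exp (408 * Real.log X ^ (3 / 100 : ℝ) * Real.log (Real.log X)) := by
  classical
  set L := Real.log X with hLdef
  set H := L ^ (1 / 50 : ℝ) with hHdef
  have hX0 : 0 < X := (Real.exp_pos 1).trans_le hXe
  have hL1 : 1 ≤ L := by rw [hLdef, ← Real.log_exp 1]; exact Real.log_le_log (Real.exp_pos 1) hXe
  have hL0 : 0 < L := by linarith
  obtain ⟨hL400, h40, hL99, hL97, h97, h9799⟩ := Lfacts hL1 c2 c3
  rw [Real.log_exp, Real.log_exp] at hv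
  have hH2 : 2 ≤ H := c2
  have hH0 : 0 < H := by linarith
  obtain ⟨hx1, hx2⟩ := div_mem_of_mem_Icc hH0 (Real.rpow_nonneg hL0.le _) hv
  set x : ℝ := (v : ℝ) / H with hxdef
  -- `x ≥ L^{97/100} - 1/2 ≥ L^{97/100}/2 ≥ 20`
  have hH1 : 1 / H ≤ 1 / 2 := by
    rw [div_le_div_iff₀ hH0 two_pos]; linarith
  have hxlo : L ^ (97 / 100 : ℝ) / 2 ≤ x := by linarith
  have hx20 : 20 ≤ x := by linarith
  have hx0 : 0 < x := by linarith
  have hXrpow : ∀ y : ℝ, X ^ y = Real.exp (L * y) := fun y => Real.rpow_def_of_pos hX0 y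
  -- `T` is large
  have hT4 : Real.exp (L / 4) ≤ T := by rw [hXrpow] at hXT; convert hXT using 2; ring
  have hT0 : 0 < T := (Real.exp_pos _).trans_le hT4
  have hlogT : L / 4 ≤ Real.log T := by
    have := Real.log_le_log (Real.exp_pos _) hT4; rwa [Real.log_exp] at this
  have hlogTL : Real.log T ≤ L := Real.log_le_log hT0 hTX
  have heT : Real.exp (Real.exp 4) ≤ T :=
    (Real.exp_le_exp.2 (by linarith [SieveIntervalSystem.exp_four_le])).trans hT4
  have hlogT1 : 1 < Real.log T := by linarith
  have hlogT0 : 0 ≤ Real.log T := by linarith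
  have hllT : Real.log (Real.log T) ≤ Real.log L := Real.log_le_log (by linarith) hlogTL
  have hllT0 : 0 ≤ Real.log (Real.log T) := Real.log_nonneg hlogT1.le
  have hlogL0 : 0 ≤ Real.log L := Real.log_nonneg hL1
  -- Lemma 8 data
  set P : ℝ := Real.exp x with hP
  set V : ℝ := L ^ 100 with hV
  have hlogP : Real.log P = x := Real.log_exp x
  have hV1 : 1 ≤ V := one_le_pow₀ hL1
  have hV0 : 0 < V := by positivity
  have hlogV : Real.log V = 100 * Real.log L := by rw [hV, Real.log_pow]; push_cast; ring
  have h2P : 2 ≤ P := by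
    have := Real.add_one_le_exp x; rw [← hP] at this; linarith
  have hP2T : P ^ 2 ≤ T := by
    have h1 : P ^ 2 = Real.exp (2 * x) := by rw [hP, ← Real.exp_nat_mul]; norm_num
    rw [h1]
    refine le_trans (Real.exp_le_exp.2 ?_) hT4
    nlinarith
  obtain ⟨a, ha⟩ : ∃ a : ℕ → ℂ, a = fun p => if p ∈ ((Icc ⌈Real.exp (L ^ (97 / 100 : ℝ))⌉₊
      ⌊Real.exp (L ^ (99 / 100 : ℝ))⌋₊).filter Nat.Prime).filter
      (fun p : ℕ => Real.exp (v / H) ≤ p ∧ (p : ℝ) < Real.exp ((v + 1) / H)) then c p else 0 := ⟨_, rfl⟩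
  have ha1 : ∀ p, ‖a p‖ ≤ 1 := fun p => by
    rw [ha]; dsimp only
    split_ifs
    · exact hc p
    · simp
  set 𝒯L := 𝒯.filter fun t => (L ^ 100)⁻¹ ≤
      ‖blockPrimePoly c (Real.exp (L ^ (97 / 100 : ℝ))) (Real.exp (L ^ (99 / 100 : ℝ))) H v t‖ with h𝒯L
  have habs : ∀ t ∈ 𝒯L, |t| ≤ T := fun t ht => by
    have h := h𝒯 t (mem_filter.1 ht).1
    rw [abs_of_nonneg (hT₀.trans h.1)]; exact h.2
  have hws' : ∀ t ∈ 𝒯L, ∀ t' ∈ 𝒯L, t ≠ t' → 1 ≤ |t - t'| := fun t ht t' ht' hne =>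
    hws t (mem_filter.1 ht).1 t' (mem_filter.1 ht').1 hne
  have hlarge : ∀ t ∈ 𝒯L, V⁻¹ ≤ ‖∑ p ∈ (Icc ⌈P⌉₊ ⌊2 * P⌋₊).filter Nat.Prime,
      a p * (p : ℂ) ^ (-(1 + (t : ℂ) * Complex.I))‖ := by
    intro t ht
    have h := (mem_filter.1 ht).2
    rw [SieveIntervalSystem.blockPrimePoly_eq_sum_Icc c _ _ hH2 v t] at h
    rw [ha]
    convert h using 3
  have h := h8 P T V a 𝒯L h2P hP2T heT hV1 ha1 habs hws' hlarge
  rw [hlogP, hlogV] at h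
  refine h.trans ?_
  -- the two exponentials
  have hLx : L / x ≤ 2 * L ^ (3 / 100 : ℝ) := by
    rw [div_le_iff₀ hx0]
    have : L ^ (97 / 100 : ℝ) * L ^ (3 / 100 : ℝ) ≤ 2 * x * L ^ (3 / 100 : ℝ) :=
      mul_le_mul_of_nonneg_right (by linarith) (Real.rpow_nonneg hL0.le _)
    nlinarith
  have hE1 : T ^ (2 * (100 * Real.log L) / x) ≤ Real.exp (400 * L ^ (3 / 100 : ℝ) * Real.log L) := by
    rw [Real.rpow_def_of_pos hT0]
    refine Real.exp_le_exp.2 ?_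
    have h1 : Real.log T * (2 * (100 * Real.log L) / x) = 200 * (Real.log T / x) * Real.log L := by ring
    rw [h1]
    have h2 : Real.log T / x ≤ L / x := div_le_div_of_nonneg_right hlogTL hx0.le
    have h3 : Real.log T / x ≤ 2 * L ^ (3 / 100 : ℝ) := h2.trans hLx
    have h4 : 200 * (Real.log T / x) * Real.log L ≤ 200 * (2 * L ^ (3 / 100 : ℝ)) * Real.log L :=
      mul_le_mul_of_nonneg_right (by linarith) hlogL0
    linarith
  have hE2 : Real.exp (4 * (Real.log T / x) * Real.log (Real.log T)) ≤
      Real.exp (8 * L ^ (3 / 100 : ℝ) * Real.log L) := by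
    refine Real.exp_le_exp.2 ?_
    have h2 : Real.log T / x ≤ 2 * L ^ (3 / 100 : ℝ) := (div_le_div_of_nonneg_right hlogTL hx0.le).trans hLx
    have h0 : 0 ≤ Real.log T / x := by positivity
    calc 4 * (Real.log T / x) * Real.log (Real.log T) ≤ 4 * (2 * L ^ (3 / 100 : ℝ)) * Real.log L :=
          mul_le_mul (by linarith) hllT hllT0 (by positivity)
      _ = 8 * L ^ (3 / 100 : ℝ) * Real.log L := by ring
  calc C₈ * V ^ 2 * T ^ (2 * (100 * Real.log L) / x) * Real.exp (4 * (Real.log T / x) * Real.log (Real.log T))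
      ≤ C₈ * V ^ 2 * Real.exp (400 * L ^ (3 / 100 : ℝ) * Real.log L) *
          Real.exp (8 * L ^ (3 / 100 : ℝ) * Real.log L) := by
        refine mul_le_mul (mul_le_mul_of_nonneg_left hE1 (by positivity)) hE2 (Real.exp_nonneg _) ?_
        positivity
    _ = C₈ * V ^ 2 * Real.exp (408 * L ^ (3 / 100 : ℝ) * Real.log L) := by
        rw [mul_assoc (C₈ * V ^ 2), ← Real.exp_add]; congr 1; congr 1; ring

/-! ### The large values `𝒯_L`: Lemma 11 -/

set_option maxHeartbeats 800000 in
/-- **Lemma 11 on `𝒯_L`** (§8.3: "Thus by Lemma 11 … `∑_{t ∈ 𝒯_L} |Q_{v,H}(1+it)|² ≪ (e^{v/H} + |𝒯_L| e^{v/H}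
exp(-(log X)^{1/5})) ∑_{e^{v/H} ≤ r ≤ e^{(v+1)/H}} 1/(r² log r) ≪ (H/v) ∑ 1/r`", with the prime block counted by
Brun–Titchmarsh), explicitly: under the size conditions `c2, c3, c6, c7` on `L = log X`, for `X^{1/4} ≤ T ≤ X`, a
`1`-spaced `𝒯 ⊂ [T₀, T]` (`T₀ ≥ 0`) and a block index `v`,
`∑_{t ∈ 𝒯, |Q_{v,H}(1+it)| ≥ L^{-100}} |Q_{v,H}(1+it)|² ≤ 24 C₁₁ C (1 + C₈)/(H (L^{97/100})²)`
(`C₁₁`, `C₈`, `C` the constants of Lemma 11 (`ε = 1/10`), Lemma 8 and Brun–Titchmarsh).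
[cite: MatomakiRadziwillAnnals2016, §8.3] -/
theorem TL_sum_sq_le {X : ℝ} {C₈ C₁₁ C : ℝ} (hC₈ : 0 ≤ C₈) (h8 : (∀ (P T V : ℝ) (a : ℕ → ℂ) (𝒯 : Finset ℝ), 2 ≤ P → P ^ 2 ≤ T →
      Real.exp (Real.exp 4) ≤ T → 1 ≤ V → (∀ p, ‖a p‖ ≤ 1) → (∀ t ∈ 𝒯, |t| ≤ T) →
      (∀ t ∈ 𝒯, ∀ t' ∈ 𝒯, t ≠ t' → 1 ≤ |t - t'|) →
      (∀ t ∈ 𝒯, V⁻¹ ≤ ‖∑ p ∈ (Finset.Icc ⌈P⌉₊ ⌊2 * P⌋₊).filter Nat.Prime,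
          a p * (p : ℂ) ^ (-(1 + (t : ℂ) * Complex.I))‖) →
      ((Finset.card 𝒯 : ℕ) : ℝ) ≤ C₈ * V ^ 2 * T ^ (2 * Real.log V / Real.log P)
        * Real.exp (4 * (Real.log T / Real.log P) * Real.log (Real.log T))))
    (hC₁₁ : 0 ≤ C₁₁) (h11 : (∀ (P T : ℝ) (a : ℕ → ℂ) (𝒯 : Finset ℝ), 2 ≤ P → 2 ≤ T →
      (∀ t ∈ 𝒯, |t| ≤ T) → (∀ t ∈ 𝒯, ∀ t' ∈ 𝒯, t ≠ t' → 1 ≤ |t - t'|) →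
      ∑ t ∈ 𝒯, ‖∑ p ∈ (Finset.Icc ⌈P⌉₊ ⌊2 * P⌋₊).filter Nat.Prime,
          a p * (p : ℂ) ^ (-((t : ℂ) * Complex.I))‖ ^ 2 ≤
        C₁₁ * (P + ((Finset.card 𝒯 : ℕ) : ℝ) * P * Real.exp (-(Real.log P / Real.log T ^ (2 / 3 + 1 / 10 : ℝ)))
            * Real.log T ^ 2)
          * ∑ p ∈ (Finset.Icc ⌈P⌉₊ ⌊2 * P⌋₊).filter Nat.Prime, ‖a p‖ ^ 2 / Real.log P)) (hC : 0 ≤ C)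
    (hBT : ∀ N M : ℕ, 2 ≤ M → (#((Ioc N (N + M)).filter Nat.Prime) : ℝ) ≤ C * M / Real.log M)
    {c : ℕ → ℂ} (hc : ∀ p, ‖c p‖ ≤ 1) (hXe : Real.exp 1 ≤ X) (c2 : 2 ≤ Real.log X ^ (1 / 50 : ℝ))
    (c3 : 40 * Real.log X ^ (99 / 100 : ℝ) ≤ Real.log X)
    (c6 : Real.log X ^ 202 * Real.exp (408 * Real.log X ^ (3 / 100 : ℝ) * Real.log (Real.log X)
      - Real.log X ^ (61 / 300 : ℝ) / 2) ≤ 1)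
    (c7 : 4 * Real.log X ≤ Real.exp (Real.log X ^ (97 / 100 : ℝ) / 2))
    {T₀ T : ℝ} (hT₀ : 0 ≤ T₀) (hXT : X ^ (1 / 4 : ℝ) ≤ T) (hTX : T ≤ X) {v : ℕ}
    (hv : v ∈ Icc ⌊Real.log X ^ (1 / 50 : ℝ) * Real.log (Real.exp (Real.log X ^ (97 / 100 : ℝ)))⌋₊
      ⌊Real.log X ^ (1 / 50 : ℝ) * Real.log (Real.exp (Real.log X ^ (99 / 100 : ℝ)))⌋₊)
    (𝒯 : Finset ℝ) (h𝒯 : ∀ t ∈ 𝒯, t ∈ Set.Icc T₀ T) (hws : ∀ t ∈ 𝒯, ∀ t' ∈ 𝒯, t ≠ t' → 1 ≤ |t - t'|) :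
    ∑ t ∈ 𝒯.filter (fun t => (Real.log X ^ 100)⁻¹ ≤
        ‖blockPrimePoly c (Real.exp (Real.log X ^ (97 / 100 : ℝ))) (Real.exp (Real.log X ^ (99 / 100 : ℝ)))
          (Real.log X ^ (1 / 50 : ℝ)) v t‖),
      ‖blockPrimePoly c (Real.exp (Real.log X ^ (97 / 100 : ℝ))) (Real.exp (Real.log X ^ (99 / 100 : ℝ)))
          (Real.log X ^ (1 / 50 : ℝ)) v t‖ ^ 2 ≤
      24 * C₁₁ * C * (1 + C₈) / (Real.log X ^ (1 / 50 : ℝ) * (Real.log X ^ (97 / 100 : ℝ)) ^ 2) := by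
  classical
  have hcard := TL_card_le hC₈ h8 hc hXe c2 c3 hT₀ hXT hTX hv 𝒯 h𝒯 hws
  set L := Real.log X with hLdef
  set H := L ^ (1 / 50 : ℝ) with hHdef
  have hX0 : 0 < X := (Real.exp_pos 1).trans_le hXe
  have hL1 : 1 ≤ L := by rw [hLdef, ← Real.log_exp 1]; exact Real.log_le_log (Real.exp_pos 1) hXe
  have hL0 : 0 < L := by linarith
  obtain ⟨hL400, h40, hL99, hL97, h97, h9799⟩ := Lfacts hL1 c2 c3
  rw [Real.log_exp, Real.log_exp] at hv
  have hH2 : 2 ≤ H := c2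
  have hH0 : 0 < H := by linarith
  obtain ⟨hx1, hx2⟩ := div_mem_of_mem_Icc hH0 (Real.rpow_nonneg hL0.le _) hv
  set x : ℝ := (v : ℝ) / H with hxdef
  have hH1 : 1 / H ≤ 1 / 2 := by
    rw [div_le_div_iff₀ hH0 two_pos]; linarith
  have hxlo : L ^ (97 / 100 : ℝ) / 2 ≤ x := by linarith
  have hx20 : 20 ≤ x := by linarith
  have hx0 : 0 < x := by linarith
  have hXrpow : ∀ y : ℝ, X ^ y = Real.exp (L * y) := fun y => Real.rpow_def_of_pos hX0 y
  have hT4 : Real.exp (L / 4) ≤ T := by rw [hXrpow] at hXT; convert hXT using 2; ring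
  have hT0 : 0 < T := (Real.exp_pos _).trans_le hT4
  have hlogT : L / 4 ≤ Real.log T := by
    have := Real.log_le_log (Real.exp_pos _) hT4; rwa [Real.log_exp] at this
  have hlogTL : Real.log T ≤ L := Real.log_le_log hT0 hTX
  have hlogT1 : 1 < Real.log T := by linarith
  have hlogT0 : 0 ≤ Real.log T := by linarith
  have h2T : 2 ≤ T := by
    have := Real.add_one_le_exp (L / 4); linarith
  -- the polynomial `Q_{v,H}(1+it) = ∑_{P' ≤ p ≤ 2P'} (a_p/p) p^{-it}`, `P' = e^x`
  set P : ℝ := Real.exp x with hP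
  have hP0 : 0 < P := Real.exp_pos x
  have hlogP : Real.log P = x := Real.log_exp x
  have h2P : 2 ≤ P := by
    have := Real.add_one_le_exp x; rw [← hP] at this; linarith
  set blk : Finset ℕ := ((Icc ⌈Real.exp (L ^ (97 / 100 : ℝ))⌉₊ ⌊Real.exp (L ^ (99 / 100 : ℝ))⌋₊).filter
      Nat.Prime).filter (fun p : ℕ => Real.exp (v / H) ≤ p ∧ (p : ℝ) < Real.exp ((v + 1) / H)) with hblk
  obtain ⟨a, ha⟩ : ∃ a : ℕ → ℂ, a = fun p => if p ∈ blk then c p else 0 := ⟨_, rfl⟩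
  set S : Finset ℕ := (Icc ⌈P⌉₊ ⌊2 * P⌋₊).filter Nat.Prime with hS
  have hSpos : ∀ p ∈ S, 0 < p := fun p hp => (mem_filter.1 hp).2.pos
  have hQ : ∀ t : ℝ, blockPrimePoly c (Real.exp (L ^ (97 / 100 : ℝ))) (Real.exp (L ^ (99 / 100 : ℝ))) H v t =
      ∑ p ∈ S, (a p / p) * (p : ℂ) ^ (-((t : ℂ) * Complex.I)) := by
    intro t
    rw [SieveIntervalSystem.blockPrimePoly_eq_sum_Icc c _ _ hH2 v t, ha]
    refine sum_congr rfl fun p hp => ?_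
    dsimp only
    rw [MatomakiRadziwillLemma12.cpw_eq_inv_mul (hSpos p hp) t]
    ring
  set 𝒯L := 𝒯.filter fun t => (L ^ 100)⁻¹ ≤
      ‖blockPrimePoly c (Real.exp (L ^ (97 / 100 : ℝ))) (Real.exp (L ^ (99 / 100 : ℝ))) H v t‖ with h𝒯L
  have habs : ∀ t ∈ 𝒯L, |t| ≤ T := fun t ht => by
    have h := h𝒯 t (mem_filter.1 ht).1
    rw [abs_of_nonneg (hT₀.trans h.1)]; exact h.2
  have hws' : ∀ t ∈ 𝒯L, ∀ t' ∈ 𝒯L, t ≠ t' → 1 ≤ |t - t'| := fun t ht t' ht' hne =>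
    hws t (mem_filter.1 ht).1 t' (mem_filter.1 ht').1 hne
  have h := h11 P T (fun p => a p / p) 𝒯L h2P h2T habs hws'
  simp_rw [hQ]
  refine h.trans ?_
  rw [hlogP]
  -- (i) the number of points: `#𝒯_L · P e^{-x/(log T)^{23/30}} (log T)² ≤ C₈ P`
  have hcnt : (#𝒯L : ℝ) * P * Real.exp (-(x / Real.log T ^ (2 / 3 + 1 / 10 : ℝ))) * Real.log T ^ 2 ≤
      C₈ * P := by
    have ha' : (2 / 3 + 1 / 10 : ℝ) = 23 / 30 := by norm_num
    rw [ha']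
    have hpowT : Real.log T ^ (23 / 30 : ℝ) ≤ L ^ (23 / 30 : ℝ) :=
      Real.rpow_le_rpow hlogT0 hlogTL (by norm_num)
    have hpowT0 : 0 < Real.log T ^ (23 / 30 : ℝ) := Real.rpow_pos_of_pos (by linarith) _
    have hsplit : L ^ (97 / 100 : ℝ) = L ^ (61 / 300 : ℝ) * L ^ (23 / 30 : ℝ) := by
      rw [← Real.rpow_add hL0]; norm_num
    have hfrac : L ^ (61 / 300 : ℝ) / 2 ≤ x / Real.log T ^ (23 / 30 : ℝ) := by
      have h1 : L ^ (97 / 100 : ℝ) / 2 / L ^ (23 / 30 : ℝ) = L ^ (61 / 300 : ℝ) / 2 := by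
        rw [hsplit]; field_simp
      rw [← h1]
      calc L ^ (97 / 100 : ℝ) / 2 / L ^ (23 / 30 : ℝ) ≤ x / L ^ (23 / 30 : ℝ) :=
            div_le_div_of_nonneg_right hxlo (Real.rpow_nonneg hL0.le _)
        _ ≤ x / Real.log T ^ (23 / 30 : ℝ) := div_le_div_of_nonneg_left hx0.le hpowT0 hpowT
    have hexp : Real.exp (-(x / Real.log T ^ (23 / 30 : ℝ))) ≤ Real.exp (-(L ^ (61 / 300 : ℝ) / 2)) :=
      Real.exp_le_exp.2 (by linarith)
    have hlog2 : Real.log T ^ 2 ≤ L ^ 2 := pow_le_pow_left₀ hlogT0 hlogTL 2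
    have hV : (L ^ 100) ^ 2 * L ^ 2 = L ^ 202 := by ring
    calc (#𝒯L : ℝ) * P * Real.exp (-(x / Real.log T ^ (23 / 30 : ℝ))) * Real.log T ^ 2
        ≤ (C₈ * (L ^ 100) ^ 2 * Real.exp (408 * L ^ (3 / 100 : ℝ) * Real.log L)) * P *
            Real.exp (-(L ^ (61 / 300 : ℝ) / 2)) * L ^ 2 := by
          refine mul_le_mul (mul_le_mul (mul_le_mul_of_nonneg_right hcard hP0.le) hexp
            (Real.exp_nonneg _) (by positivity)) hlog2 (by positivity) (by positivity)
      _ = C₈ * P * (L ^ 202 * Real.exp (408 * L ^ (3 / 100 : ℝ) * Real.log L - L ^ (61 / 300 : ℝ) / 2)) := by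
          rw [sub_eq_add_neg, Real.exp_add, ← hV]; ring
      _ ≤ C₈ * P * 1 := mul_le_mul_of_nonneg_left c6 (by positivity)
      _ = C₈ * P := mul_one _
  -- (ii) the coefficients: `∑_{p} |a_p/p|²/x ≤ #blk/(P² x)`
  have hcoef : ∑ p ∈ S, ‖a p / p‖ ^ 2 / x ≤ #blk * (1 / P ^ 2 / x) := by
    have hle : ∀ p ∈ S, ‖a p / p‖ ^ 2 / x ≤ if p ∈ blk then 1 / P ^ 2 / x else 0 := by
      intro p hp
      rw [ha]; dsimp only
      split_ifs with hpb
      · refine div_le_div_of_nonneg_right ?_ hx0.le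
        have hpP : P ≤ p := by
          have := (mem_filter.1 hpb).2.1
          rwa [hP, hxdef]
        have hp0 : (0 : ℝ) < p := hP0.trans_le hpP
        rw [norm_div, div_pow, Complex.norm_natCast]
        calc ‖c p‖ ^ 2 / (p : ℝ) ^ 2 ≤ 1 / (p : ℝ) ^ 2 := by
              refine div_le_div_of_nonneg_right ?_ (by positivity)
              have := hc p
              have h0 := norm_nonneg (c p)
              nlinarith
          _ ≤ 1 / P ^ 2 := div_le_div_of_nonneg_left zero_le_one (by positivity)
              (pow_le_pow_left₀ hP0.le hpP 2)
      · simp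
    refine (sum_le_sum hle).trans ?_
    rw [sum_ite_mem, sum_const, nsmul_eq_mul]
    refine mul_le_mul_of_nonneg_right ?_ (by positivity)
    exact_mod_cast card_le_card inter_subset_right
  -- (iii) the block is short: `#blk ≤ 6 C P/(H x)`
  have hblkcard : (#blk : ℝ) ≤ 6 * C * Real.exp (v / H) / (H * (v / H)) := by
    refine card_primes_block_le hC hBT _ _ (by linarith) v ?_
    rw [← hxdef, ← hP]
    have hH2L : H ^ 2 ≤ L := by
      rw [hHdef, ← Real.rpow_natCast, ← Real.rpow_mul hL0.le]
      norm_num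
      refine (Real.rpow_le_rpow_of_exponent_le hL1 (show (1 / 25 : ℝ) ≤ 1 by norm_num)).trans ?_
      rw [Real.rpow_one]
    have hPlo : Real.exp (L ^ (97 / 100 : ℝ) / 2) ≤ P := Real.exp_le_exp.2 hxlo
    linarith
  rw [← hxdef, ← hP] at hblkcard
  -- combine
  have hfac1 : P + (#𝒯L : ℝ) * P * Real.exp (-(x / Real.log T ^ (2 / 3 + 1 / 10 : ℝ))) * Real.log T ^ 2 ≤
      P * (1 + C₈) := by linarith
  have hfac2 : ∑ p ∈ S, ‖a p / p‖ ^ 2 / x ≤ 6 * C * P / (H * x) * (1 / P ^ 2 / x) :=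
    hcoef.trans (mul_le_mul_of_nonneg_right hblkcard (by positivity))
  have hsum0 : 0 ≤ ∑ p ∈ S, ‖a p / p‖ ^ 2 / x := sum_nonneg fun p _ => by positivity
  calc C₁₁ * (P + (#𝒯L : ℝ) * P * Real.exp (-(x / Real.log T ^ (2 / 3 + 1 / 10 : ℝ))) * Real.log T ^ 2) *
        ∑ p ∈ S, ‖a p / p‖ ^ 2 / x
      ≤ C₁₁ * (P * (1 + C₈)) * (6 * C * P / (H * x) * (1 / P ^ 2 / x)) :=
        mul_le_mul (mul_le_mul_of_nonneg_left hfac1 hC₁₁) hfac2 hsum0 (by positivity)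
    _ = 6 * C₁₁ * C * (1 + C₈) / (H * x ^ 2) := by
        field_simp
    _ ≤ 24 * C₁₁ * C * (1 + C₈) / (H * (L ^ (97 / 100 : ℝ)) ^ 2) := by
        rw [div_le_div_iff₀ (by positivity) (by positivity)]
        have hx2 : (L ^ (97 / 100 : ℝ)) ^ 2 ≤ 4 * x ^ 2 := by nlinarith [Real.rpow_nonneg hL0.le (97 / 100 : ℝ)]
        have h0 : 0 ≤ 6 * C₁₁ * C * (1 + C₈) * H := by positivity
        nlinarith [mul_le_mul_of_nonneg_left hx2 h0]

/-! ### The Halász bound for the cofactor polynomial: Lemma 3 with Lemma 5 -/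

/-- The right-hand side of Lemma 3 at `P = exp(L^{97/100})`, `Q = exp(L^{99/100})`, `log X' = y ∈ [L/2, L]`:
`L^{99/100}/(y^{1/16} L^{97/100}) + y exp(-(y/(3L^{99/100})) log(y/L^{99/100})) ≤ 3 L^{1/50-1/16}` under the size
conditions `c2, c3, c5` ("`≪ (log X)^{-1/16+o(1)} log Q/log P`", §8.3). [cite: MatomakiRadziwillAnnals2016, §8.3] -/
theorem lemma3_rhs_le {L y : ℝ} (hL1 : 1 ≤ L) (c2 : 2 ≤ L ^ (1 / 50 : ℝ)) (c3 : 40 * L ^ (99 / 100 : ℝ) ≤ L)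
    (c5 : L * Real.exp (-(L ^ (1 / 100 : ℝ) / 6)) ≤ L ^ (1 / 50 - 1 / 16 : ℝ)) (hy1 : L / 2 ≤ y) (hy2 : y ≤ L) :
    L ^ (99 / 100 : ℝ) / (y ^ (1 / 16 : ℝ) * L ^ (97 / 100 : ℝ)) +
      y * Real.exp (-(y / (3 * L ^ (99 / 100 : ℝ))) * Real.log (y / L ^ (99 / 100 : ℝ))) ≤
      3 * L ^ (1 / 50 - 1 / 16 : ℝ) := by
  have hL0 : 0 < L := by linarith
  obtain ⟨hL400, h40, hL99, hL97, h97, h9799⟩ := Lfacts hL1 c2 c3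
  have hy0 : 0 < y := by linarith
  have h99pos : 0 < L ^ (99 / 100 : ℝ) := Real.rpow_pos_of_pos hL0 _
  have h97pos : 0 < L ^ (97 / 100 : ℝ) := Real.rpow_pos_of_pos hL0 _
  -- first term
  have h1 : L ^ (99 / 100 : ℝ) / (y ^ (1 / 16 : ℝ) * L ^ (97 / 100 : ℝ)) ≤ 2 * L ^ (1 / 50 - 1 / 16 : ℝ) := by
    have hy16 : L ^ (1 / 16 : ℝ) / 2 ≤ y ^ (1 / 16 : ℝ) := by
      have ha : (L / 2) ^ (1 / 16 : ℝ) ≤ y ^ (1 / 16 : ℝ) := Real.rpow_le_rpow (by linarith) hy1 (by norm_num)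
      have hb : (L / 2) ^ (1 / 16 : ℝ) = L ^ (1 / 16 : ℝ) / 2 ^ (1 / 16 : ℝ) :=
        Real.div_rpow hL0.le zero_le_two _
      have hc : (2 : ℝ) ^ (1 / 16 : ℝ) ≤ 2 := by
        conv_rhs => rw [← Real.rpow_one 2]
        exact Real.rpow_le_rpow_of_exponent_le one_le_two (by norm_num)
      have hd : L ^ (1 / 16 : ℝ) / 2 ≤ L ^ (1 / 16 : ℝ) / 2 ^ (1 / 16 : ℝ) :=
        div_le_div_of_nonneg_left (Real.rpow_nonneg hL0.le _) (by positivity) hc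
      linarith
    have h16pos : 0 < L ^ (1 / 16 : ℝ) := Real.rpow_pos_of_pos hL0 _
    have hsplit1 : L ^ (99 / 100 : ℝ) = L ^ (1 / 50 - 1 / 16 : ℝ) * L ^ (1 / 16 : ℝ) * L ^ (97 / 100 : ℝ) := by
      rw [← Real.rpow_add hL0, ← Real.rpow_add hL0]; norm_num
    rw [hsplit1, div_le_iff₀ (by positivity)]
    have h0 : 0 ≤ L ^ (1 / 50 - 1 / 16 : ℝ) * L ^ (97 / 100 : ℝ) := by positivity
    nlinarith [mul_le_mul_of_nonneg_left hy16 h0]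
  -- second term
  have h2 : y * Real.exp (-(y / (3 * L ^ (99 / 100 : ℝ))) * Real.log (y / L ^ (99 / 100 : ℝ))) ≤
      L ^ (1 / 50 - 1 / 16 : ℝ) := by
    set u := y / L ^ (99 / 100 : ℝ) with hu
    have hulo : L ^ (1 / 100 : ℝ) / 2 ≤ u := by
      rw [hu, le_div_iff₀ h99pos]
      have : L ^ (99 / 100 : ℝ) * L ^ (1 / 100 : ℝ) ≤ 2 * y := by linarith
      nlinarith [this]
    have hu20 : 20 ≤ u := by linarith
    have hlogu : 1 ≤ Real.log u := by
      rw [← Real.log_exp 1]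
      exact Real.log_le_log (Real.exp_pos 1) (by linarith [Real.exp_one_lt_three])
    have hexp : Real.exp (-(y / (3 * L ^ (99 / 100 : ℝ))) * Real.log u) ≤ Real.exp (-(L ^ (1 / 100 : ℝ) / 6)) := by
      refine Real.exp_le_exp.2 ?_
      have he : y / (3 * L ^ (99 / 100 : ℝ)) = u / 3 := by rw [hu]; field_simp
      rw [he]
      have hu3 : L ^ (1 / 100 : ℝ) / 6 ≤ u / 3 := by linarith
      have hu0 : 0 ≤ u / 3 := by linarith
      nlinarith [mul_le_mul_of_nonneg_left hlogu hu0]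
    calc y * Real.exp (-(y / (3 * L ^ (99 / 100 : ℝ))) * Real.log u)
        ≤ L * Real.exp (-(L ^ (1 / 100 : ℝ) / 6)) := mul_le_mul hy2 hexp (Real.exp_nonneg _) hL0.le
      _ ≤ L ^ (1 / 50 - 1 / 16 : ℝ) := c5
  linarith

end MatomakiRadziwillU

namespace SieveIntervalSystem

variable {η X : ℝ} (I : SieveIntervalSystem η X)

/-- **Lemma 5 inside the cofactor polynomial**: with `b = f 1_𝒮`,
`R_{v,H}(1+it) = ∑_{𝒥 ⊆ [1,J]} (-1)^{#𝒥} ∑_{X' ≤ m ≤ 2X'} (f g_𝒥)(m) m^{-1-it}/(ω(m)+1)`, `X' = X e^{-v/H}`.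
[cite: MatomakiRadziwillAnnals2016, Lemma 5 and §8.3] -/
theorem blockCofactorPoly_aCoef_eq (f : ArithmeticFunction ℝ) (P Q H : ℝ) (v : ℕ) (t : ℝ) :
    blockCofactorPoly (I.aCoef f) X P Q H v t =
      ∑ 𝒥 ∈ (Icc 1 I.J).powerset, ((-1 : ℝ) ^ #𝒥) •
        ∑ m ∈ Icc ⌈X * Real.exp (-(v / H))⌉₊ ⌊2 * (X * Real.exp (-(v / H)))⌋₊,
          ((f.pmul (I.g 𝒥)) m : ℂ) * (m : ℂ) ^ (-(1 + (t : ℂ) * Complex.I)) / ((primeDivisorsIn P Q m : ℂ) + 1) := by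
  classical
  unfold blockCofactorPoly
  rw [mul_assoc]
  set s := Icc ⌈X * Real.exp (-(v / H))⌉₊ ⌊2 * (X * Real.exp (-(v / H)))⌋₊
  have h1 : ∑ m ∈ s, I.aCoef f m * (m : ℂ) ^ (-(1 + (t : ℂ) * Complex.I)) / ((primeDivisorsIn P Q m : ℂ) + 1) =
      ∑ m ∈ s.filter I.Mem, (f m : ℂ) * (m : ℂ) ^ (-(1 + (t : ℂ) * Complex.I)) / ((primeDivisorsIn P Q m : ℂ) + 1) := by
    rw [sum_filter]
    refine sum_congr rfl fun m _ => ?_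
    unfold aCoef
    split_ifs <;> simp
  rw [h1, I.sum_filter_mem_eq s]
  refine sum_congr rfl fun 𝒥 _ => ?_
  congr 1
  refine sum_congr rfl fun m _ => ?_
  rw [Complex.real_smul, ArithmeticFunction.pmul_apply]
  push_cast
  ring

/-- `|f g_𝒥| ≤ 1`. [folklore] -/
theorem abs_pmul_g_le {f : ArithmeticFunction ℝ} (hf1 : ∀ n, |f n| ≤ 1) (𝒥 : Finset ℕ) (n : ℕ) :
    |(f.pmul (I.g 𝒥)) n| ≤ 1 := by
  rw [ArithmeticFunction.pmul_apply, abs_mul]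
  have h1 := hf1 n
  have h2 := I.abs_g_le_one 𝒥 n
  have h0 := abs_nonneg (f n)
  nlinarith

set_option maxHeartbeats 400000 in
/-- **The Halász bound for `R_{v,H}`** (§8.3: "by Lemmas 3 and 5 (since `2^J ≪ (log X)^{o(1)}`),
`max_{(log X)^{1/15} ≤ |u| ≤ T} |R_{v,H}(1+iu)| ≪ (log X)^{-1/16+o(1)} log Q/log P`"), explicitly: under the size
conditions `c2, c3, c5`, for `(log X)^{1/15} ≤ t ≤ T ≤ X` and a block index `v`,
`|R_{v,H}(1+it)| ≤ 2^J · 3 C₃ L^{1/50-1/16}` (`C₃` the constant of Lemma 3 for `A = 2`, applied to the `2^J`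
multiplicative functions `f g_𝒥` at `X' = X e^{-v/H} ∈ [X^{1/2}, X]`). [cite: MatomakiRadziwillAnnals2016, §8.3] -/
theorem norm_blockCofactorPoly_le {C₃ : ℝ} (hC₃ : 0 ≤ C₃) (h3 : (∀ f : ArithmeticFunction ℝ, f.IsMultiplicative → (∀ n, |f n| ≤ 1) →
      ∀ X P Q t : ℝ, 2 ≤ P → P ≤ Q → Q ≤ X → Real.log X ^ (1 / 16 : ℝ) ≤ t → t ≤ X ^ (2 : ℝ) →
        ‖∑ n ∈ Finset.Icc ⌈X⌉₊ ⌊2 * X⌋₊,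
            (f n : ℂ) * (n : ℂ) ^ (-(1 + (t : ℂ) * Complex.I)) / ((primeDivisorsIn P Q n : ℂ) + 1)‖ ≤
          C₃ * (Real.log Q / (Real.log X ^ (1 / 16 : ℝ) * Real.log P)
            + Real.log X * Real.exp (-(Real.log X / (3 * Real.log Q)) * Real.log (Real.log X / Real.log Q))))) (f : ArithmeticFunction ℝ)
    (hf : f.IsMultiplicative) (hf1 : ∀ n, |f n| ≤ 1) (hXe : Real.exp 1 ≤ X)
    (c2 : 2 ≤ Real.log X ^ (1 / 50 : ℝ)) (c3 : 40 * Real.log X ^ (99 / 100 : ℝ) ≤ Real.log X)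
    (c5 : Real.log X * Real.exp (-(Real.log X ^ (1 / 100 : ℝ) / 6)) ≤ Real.log X ^ (1 / 50 - 1 / 16 : ℝ))
    {T t : ℝ} (hTX : T ≤ X) (ht : t ∈ Set.Icc (Real.log X ^ (1 / 15 : ℝ)) T) {v : ℕ}
    (hv : v ∈ Icc ⌊Real.log X ^ (1 / 50 : ℝ) * Real.log (Real.exp (Real.log X ^ (97 / 100 : ℝ)))⌋₊
      ⌊Real.log X ^ (1 / 50 : ℝ) * Real.log (Real.exp (Real.log X ^ (99 / 100 : ℝ)))⌋₊) :
    ‖blockCofactorPoly (I.aCoef f) X (Real.exp (Real.log X ^ (97 / 100 : ℝ)))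
        (Real.exp (Real.log X ^ (99 / 100 : ℝ))) (Real.log X ^ (1 / 50 : ℝ)) v t‖ ≤
      2 ^ I.J * (3 * C₃ * Real.log X ^ (1 / 50 - 1 / 16 : ℝ)) := by
  classical
  set L := Real.log X with hLdef
  set H := L ^ (1 / 50 : ℝ) with hHdef
  have hX0 : 0 < X := (Real.exp_pos 1).trans_le hXe
  have hL1 : 1 ≤ L := by rw [hLdef, ← Real.log_exp 1]; exact Real.log_le_log (Real.exp_pos 1) hXe
  have hL0 : 0 < L := by linarith
  obtain ⟨hL400, h40, hL99, hL97, h97, h9799⟩ := MatomakiRadziwillU.Lfacts hL1 c2 c3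
  rw [Real.log_exp, Real.log_exp] at hv
  have hH2 : 2 ≤ H := c2
  have hH0 : 0 < H := by linarith
  obtain ⟨hx1, hx2⟩ := MatomakiRadziwillU.div_mem_of_mem_Icc hH0 (Real.rpow_nonneg hL0.le _) hv
  set x : ℝ := (v : ℝ) / H with hxdef
  have hx0 : 0 ≤ x := by positivity
  -- `X' = X e^{-x}`, `log X' = L - x ∈ [L/2, L]`
  set X' : ℝ := X * Real.exp (-x) with hX'def
  have hX'0 : 0 < X' := by positivity
  have hlogX' : Real.log X' = L - x := by
    rw [hX'def, Real.log_mul hX0.ne' (Real.exp_pos _).ne', Real.log_exp]; ring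
  have hy1 : L / 2 ≤ Real.log X' := by
    rw [hlogX']
    have : L ^ (99 / 100 : ℝ) ≤ L / 40 := by linarith
    linarith
  have hy2 : Real.log X' ≤ L := by rw [hlogX']; linarith
  have hX'exp : X' = Real.exp (Real.log X') := (Real.exp_log hX'0).symm
  -- hypotheses of Lemma 3
  have hP2 : 2 ≤ Real.exp (L ^ (97 / 100 : ℝ)) := by
    have := Real.add_one_le_exp (L ^ (97 / 100 : ℝ)); linarith
  have hPQ : Real.exp (L ^ (97 / 100 : ℝ)) ≤ Real.exp (L ^ (99 / 100 : ℝ)) := Real.exp_le_exp.2 h9799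
  have hQX' : Real.exp (L ^ (99 / 100 : ℝ)) ≤ X' := by
    rw [hX'exp]
    refine Real.exp_le_exp.2 ?_
    have : L ^ (99 / 100 : ℝ) ≤ L / 40 := by linarith
    linarith
  have ht1 : Real.log X' ^ (1 / 16 : ℝ) ≤ t := by
    have h1 : Real.log X' ^ (1 / 16 : ℝ) ≤ L ^ (1 / 16 : ℝ) :=
      Real.rpow_le_rpow (by linarith) hy2 (by norm_num)
    have h2 : L ^ (1 / 16 : ℝ) ≤ L ^ (1 / 15 : ℝ) := Real.rpow_le_rpow_of_exponent_le hL1 (by norm_num)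
    exact h1.trans (h2.trans ht.1)
  have ht2 : t ≤ X' ^ (2 : ℝ) := by
    rw [Real.rpow_def_of_pos hX'0]
    have hX : X = Real.exp L := by rw [hLdef, Real.exp_log hX0]
    have h1 : t ≤ Real.exp L := hX ▸ (ht.2.trans hTX)
    exact h1.trans (Real.exp_le_exp.2 (by linarith))
  -- Lemma 5 and the triangle inequality
  rw [I.blockCofactorPoly_aCoef_eq f _ _ H v t]
  have hxH : -((v : ℝ) / H) = -x := by rw [hxdef]
  simp only [hxH]
  refine (norm_sum_le _ _).trans ?_
  have hterm : ∀ 𝒥 ∈ (Icc 1 I.J).powerset,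
      ‖((-1 : ℝ) ^ #𝒥) • ∑ m ∈ Icc ⌈X * Real.exp (-x)⌉₊ ⌊2 * (X * Real.exp (-x))⌋₊,
          ((f.pmul (I.g 𝒥)) m : ℂ) * (m : ℂ) ^ (-(1 + (t : ℂ) * Complex.I)) /
            ((primeDivisorsIn (Real.exp (L ^ (97 / 100 : ℝ))) (Real.exp (L ^ (99 / 100 : ℝ))) m : ℂ) + 1)‖ ≤
        3 * C₃ * L ^ (1 / 50 - 1 / 16 : ℝ) := by
    intro 𝒥 _
    rw [norm_smul, norm_pow, norm_neg, norm_one, one_pow, one_mul]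
    have h := h3 (f.pmul (I.g 𝒥)) (hf.pmul (I.isMultiplicative_g 𝒥)) (I.abs_pmul_g_le hf1 𝒥) X'
      (Real.exp (L ^ (97 / 100 : ℝ))) (Real.exp (L ^ (99 / 100 : ℝ))) t hP2 hPQ hQX' ht1 ht2
    rw [Real.log_exp, Real.log_exp] at h
    refine h.trans ?_
    have hB := MatomakiRadziwillU.lemma3_rhs_le hL1 c2 c3 c5 hy1 hy2
    calc C₃ * (L ^ (99 / 100 : ℝ) / (Real.log X' ^ (1 / 16 : ℝ) * L ^ (97 / 100 : ℝ)) +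
          Real.log X' * Real.exp (-(Real.log X' / (3 * L ^ (99 / 100 : ℝ))) *
            Real.log (Real.log X' / L ^ (99 / 100 : ℝ))))
        ≤ C₃ * (3 * L ^ (1 / 50 - 1 / 16 : ℝ)) := mul_le_mul_of_nonneg_left hB hC₃
      _ = 3 * C₃ * L ^ (1 / 50 - 1 / 16 : ℝ) := by ring
  refine (sum_le_sum hterm).trans ?_
  rw [sum_const, nsmul_eq_mul, card_powerset, Nat.card_Icc, Nat.add_sub_cancel]
  push_cast
  rfl

/-! ### The small values `𝒯_S`: the explicit bound -/

/-- `#ℐ_J ≤ 2 · 4^19 (log X)^{1/14} e^{(√log X)/6} √log X` (`#ℐ_J ≤ 2 H_J log Q_J`, `H_J = J² H₁`, `J² ≤ 4^J ≤ 4^19 (log X)^{1/14}`,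
`H₁ ≤ P₁^{1/6} ≤ Q_J^{1/6} ≤ e^{(√log X)/6}`, `log Q_J ≤ √log X`), for `H₁ ≥ 1`, `log X ≥ 1`. [folklore] -/
theorem card_blocks_J_le (hη : 0 < η) (hη6 : η < 1 / 6) (hL1 : 1 ≤ Real.log X) (hH1 : 1 ≤ I.Hpar 1) :
    (#(I.blocks I.J) : ℝ) ≤ 2 * 4 ^ 19 * Real.log X ^ (1 / 14 : ℝ) * Real.exp (Real.sqrt (Real.log X) / 6) *
      Real.sqrt (Real.log X) := by
  have hη' : η ≤ 8 := by linarith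
  have hη'' : η ≤ 1 / 6 := hη6.le
  have hJ1 := I.one_le_J
  have h1 := I.card_blocks_le hη hη'' hJ1 (hH1.trans (I.Hpar_one_le hη hη' hJ1))
  have hQJ : Real.log (I.Q I.J) ≤ Real.sqrt (Real.log X) := by
    have := Real.log_le_log (I.pos_Q hJ1) I.Q_J_le; rwa [Real.log_exp] at this
  have hQJ0 : 0 ≤ Real.log (I.Q I.J) := MatomakiRadziwillThm3.logQ_nonneg I hη hJ1
  -- `H_J = J² H₁ ≤ 4^J e^{√L/6}`
  have hH1le : I.Hpar 1 ≤ Real.exp (Real.sqrt (Real.log X) / 6) := by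
    have hP1 : 1 ≤ I.P 1 := I.one_le_P_one
    have hQ1 : 1 < Real.log (I.Q 1) := I.one_lt_log_Q_one hη hη'
    have hP1Q : I.P 1 ≤ I.Q I.J := by
      refine (I.P_le_Q 1 le_rfl).trans ?_
      rcases eq_or_lt_of_le hJ1 with h | h
      · rw [← h]
      · exact (I.Q_lt_Q hη hη' le_rfl h).le
    unfold Hpar
    simp only [Nat.cast_one, one_pow, one_mul]
    have hden : 1 ≤ Real.log (I.Q 1) ^ (1 / 3 : ℝ) := Real.one_le_rpow hQ1.le (by norm_num)
    calc I.P 1 ^ (1 / 6 - η) / Real.log (I.Q 1) ^ (1 / 3 : ℝ) ≤ I.P 1 ^ (1 / 6 - η) :=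
          div_le_self (Real.rpow_nonneg (by linarith) _) hden
      _ ≤ I.P 1 ^ (1 / 6 : ℝ) := Real.rpow_le_rpow_of_exponent_le hP1 (by linarith)
      _ ≤ I.Q I.J ^ (1 / 6 : ℝ) := Real.rpow_le_rpow (by linarith) hP1Q (by norm_num)
      _ ≤ Real.exp (Real.sqrt (Real.log X)) ^ (1 / 6 : ℝ) :=
          Real.rpow_le_rpow (I.pos_Q hJ1).le I.Q_J_le (by norm_num)
      _ = Real.exp (Real.sqrt (Real.log X) / 6) := by
          rw [← Real.exp_mul]; congr 1; ring
  have hJsq : ((I.J : ℝ)) ^ 2 ≤ 4 ^ I.J := by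
    have h := Nat.lt_two_pow_self (n := I.J)
    have h' : ((I.J : ℝ)) ≤ 2 ^ I.J := by exact_mod_cast h.le
    calc ((I.J : ℝ)) ^ 2 ≤ (2 ^ I.J) ^ 2 := pow_le_pow_left₀ (Nat.cast_nonneg _) h' 2
      _ = 4 ^ I.J := by rw [← pow_mul, mul_comm, pow_mul]; norm_num
  have h4J := MatomakiRadziwillThm3.four_pow_J_le I hη hη'' hL1
  have hHJ : I.Hpar I.J ≤ 4 ^ 19 * Real.log X ^ (1 / 14 : ℝ) * Real.exp (Real.sqrt (Real.log X) / 6) := by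
    rw [I.Hpar_eq]
    have h0 : 0 ≤ I.Hpar 1 := by linarith
    calc ((I.J : ℝ)) ^ 2 * I.Hpar 1 ≤ 4 ^ I.J * I.Hpar 1 := mul_le_mul_of_nonneg_right hJsq h0
      _ ≤ (4 ^ 19 * Real.log X ^ (1 / 14 : ℝ)) * Real.exp (Real.sqrt (Real.log X) / 6) :=
          mul_le_mul h4J hH1le h0 (by positivity)
  calc (#(I.blocks I.J) : ℝ) ≤ 2 * (I.Hpar I.J * Real.log (I.Q I.J)) := h1
    _ ≤ 2 * ((4 ^ 19 * Real.log X ^ (1 / 14 : ℝ) * Real.exp (Real.sqrt (Real.log X) / 6)) *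
          Real.sqrt (Real.log X)) := by
        refine mul_le_mul_of_nonneg_left (mul_le_mul hHJ hQJ hQJ0 (by positivity)) (by norm_num)
    _ = _ := by ring

/-- The numerics of the `𝒯_S` bound: with `X' = e^{L-x}`, `x ≤ L^{99/100}`, `√T ≤ e^{L/2}`,
`#𝒯 ≤ #ℐ_J C₈ e^{√L/2} e^{L(1/2-2η)}`, `#ℐ_J ≤ 2·4^19 L^{1/14} e^{√L/6} √L`, `log(2T) ≤ 2L` and `c4`:
`C₉ (2X' + #𝒯 √T) log(2T) (2/X') ≤ 2 C₉ (4 + 4^20 C₈) L`. [folklore] -/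
theorem TS_numeric {C₈ C₉ L x η NJ NT sT lg X' : ℝ} (hC₈ : 0 ≤ C₈) (hC₉ : 0 ≤ C₉)
    (hX' : X' = Real.exp (L - x)) (hx : x ≤ L ^ (99 / 100 : ℝ)) (hsT : sT ≤ Real.exp (L / 2)) (hsT0 : 0 ≤ sT)
    (hNT0 : 0 ≤ NT)
    (hNT : NT ≤ NJ * (C₈ * Real.exp (Real.sqrt L / 2) * Real.exp (L * (1 / 2 - 2 * η))))
    (hNJ : NJ ≤ 2 * 4 ^ 19 * L ^ (1 / 14 : ℝ) * Real.exp (Real.sqrt L / 6) * Real.sqrt L)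
    (c4 : L ^ (1 / 14 : ℝ) * Real.sqrt L *
      Real.exp (2 / 3 * Real.sqrt L + L ^ (99 / 100 : ℝ) - 2 * η * L) ≤ 1)
    (hlg : lg ≤ 2 * L) (hlg0 : 0 ≤ lg) :
    C₉ * (2 * X' + NT * sT) * lg * (2 / X') ≤ 2 * C₉ * (4 + 4 ^ 20 * C₈) * L := by
  have hX'0 : 0 < X' := by rw [hX']; exact Real.exp_pos _
  -- `#𝒯 √T ≤ 2·4^19 C₈ X'`
  have h1 : NT * sT ≤ NJ * C₈ * Real.exp (Real.sqrt L / 2 + L * (1 / 2 - 2 * η) + L / 2) := by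
    calc NT * sT ≤ (NJ * (C₈ * Real.exp (Real.sqrt L / 2) * Real.exp (L * (1 / 2 - 2 * η)))) *
          Real.exp (L / 2) := mul_le_mul hNT hsT hsT0 (hNT0.trans hNT)
      _ = NJ * C₈ * (Real.exp (Real.sqrt L / 2) * Real.exp (L * (1 / 2 - 2 * η)) * Real.exp (L / 2)) := by
          ring
      _ = NJ * C₈ * Real.exp (Real.sqrt L / 2 + L * (1 / 2 - 2 * η) + L / 2) := by
          rw [Real.exp_add, Real.exp_add]
  have hNJ0 : 0 ≤ NJ * (C₈ * Real.exp (Real.sqrt L / 2) * Real.exp (L * (1 / 2 - 2 * η))) := hNT0.trans hNT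
  have h2 : NJ * C₈ * Real.exp (Real.sqrt L / 2 + L * (1 / 2 - 2 * η) + L / 2) ≤
      (2 * 4 ^ 19 * L ^ (1 / 14 : ℝ) * Real.exp (Real.sqrt L / 6) * Real.sqrt L) * C₈ *
        Real.exp (Real.sqrt L / 2 + L * (1 / 2 - 2 * η) + L / 2) := by
    rcases eq_or_lt_of_le hC₈ with h0 | h0
    · rw [← h0]; simp
    · refine mul_le_mul_of_nonneg_right (mul_le_mul_of_nonneg_right hNJ hC₈) (Real.exp_nonneg _)
  have h3 : (2 * 4 ^ 19 * L ^ (1 / 14 : ℝ) * Real.exp (Real.sqrt L / 6) * Real.sqrt L) * C₈ *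
        Real.exp (Real.sqrt L / 2 + L * (1 / 2 - 2 * η) + L / 2) =
      2 * 4 ^ 19 * C₈ * (L ^ (1 / 14 : ℝ) * Real.sqrt L *
        Real.exp (2 / 3 * Real.sqrt L + L ^ (99 / 100 : ℝ) - 2 * η * L)) * Real.exp (L - L ^ (99 / 100 : ℝ)) := by
    have e : Real.exp (Real.sqrt L / 6) * Real.exp (Real.sqrt L / 2 + L * (1 / 2 - 2 * η) + L / 2) =
        Real.exp (2 / 3 * Real.sqrt L + L ^ (99 / 100 : ℝ) - 2 * η * L) * Real.exp (L - L ^ (99 / 100 : ℝ)) := by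
      rw [← Real.exp_add, ← Real.exp_add]; congr 1; ring
    calc (2 * 4 ^ 19 * L ^ (1 / 14 : ℝ) * Real.exp (Real.sqrt L / 6) * Real.sqrt L) * C₈ *
          Real.exp (Real.sqrt L / 2 + L * (1 / 2 - 2 * η) + L / 2)
        = 2 * 4 ^ 19 * C₈ * (L ^ (1 / 14 : ℝ) * Real.sqrt L) * (Real.exp (Real.sqrt L / 6) *
            Real.exp (Real.sqrt L / 2 + L * (1 / 2 - 2 * η) + L / 2)) := by ring
      _ = _ := by rw [e]; ring
  have h4 : 2 * 4 ^ 19 * C₈ * (L ^ (1 / 14 : ℝ) * Real.sqrt L *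
        Real.exp (2 / 3 * Real.sqrt L + L ^ (99 / 100 : ℝ) - 2 * η * L)) * Real.exp (L - L ^ (99 / 100 : ℝ)) ≤
      2 * 4 ^ 19 * C₈ * 1 * X' := by
    rw [hX']
    exact mul_le_mul (mul_le_mul_of_nonneg_left c4 (by positivity)) (Real.exp_le_exp.2 (by linarith))
      (Real.exp_nonneg _) (by positivity)
  have hkey : NT * sT ≤ 2 * 4 ^ 19 * C₈ * X' := by
    have := h1.trans (h2.trans (h3.le.trans h4)); linarith
  -- conclude
  have hprod : (2 * X' + NT * sT) * (2 / X') ≤ 4 + 4 ^ 20 * C₈ := by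
    have e1 : 2 * X' * (2 / X') = 4 := by
      rw [mul_div_assoc', div_eq_iff hX'0.ne']; ring
    have e2 : (2 * X' + NT * sT) * (2 / X') = 4 + 2 * (NT * sT / X') := by
      rw [add_mul, e1]; ring
    rw [e2]
    have h5 : NT * sT / X' ≤ 2 * 4 ^ 19 * C₈ := by rw [div_le_iff₀ hX'0]; exact hkey
    have h6 : (4 : ℝ) ^ 20 = 2 * (2 * 4 ^ 19) := by norm_num
    rw [h6]
    linarith
  have hL0 : 0 ≤ 2 * L := by linarith
  calc C₉ * (2 * X' + NT * sT) * lg * (2 / X')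
      = C₉ * lg * ((2 * X' + NT * sT) * (2 / X')) := by ring
    _ ≤ C₉ * (2 * L) * (4 + 4 ^ 20 * C₈) := by
        refine mul_le_mul (mul_le_mul_of_nonneg_left hlg hC₉) hprod ?_ (by positivity)
        exact mul_nonneg (by positivity) (by positivity)
    _ = 2 * C₉ * (4 + 4 ^ 20 * C₈) * L := by ring

set_option maxHeartbeats 400000 in
/-- **The small values** (§8.3: "By Lemma 9, `∑_{t ∈ 𝒯_S} |Q_{v,H} R_{v,H}|² ≪ (log X)^{-200} (X e^{-v/H} + |𝒯| T^{1/2})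
log(2T) (X e^{-v/H})⁻¹ ≪ (log X)^{-199}`"), explicitly: under `c2, c3` and the `η`-dependent size condition
`c4 : L^{1/14} √L exp((2/3)√L + L^{99/100} - 2ηL) ≤ 1` (`L = log X`), for `X^{1/4} ≤ T ≤ X`, `H₁ ≥ 2`, a `1`-spaced
`𝒯 ⊂ [T₀, T]` with `#𝒯 ≤ #ℐ_J C₈ e^{(√L)/2} X^{1/2-2η}` (`card_witness_le`) and a block index `v`:
`∑_{t ∈ 𝒯, |Q_{v,H}| < L^{-100}} |Q_{v,H} R_{v,H}|² ≤ 2 C₉ (4 + 4^20 C₈) L · L^{-200}`.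
[cite: MatomakiRadziwillAnnals2016, §8.3] -/
theorem TS_sum_le {C₈ C₉ : ℝ} (hC₈ : 0 ≤ C₈) (hC₉ : 0 ≤ C₉) (h9 : (∀ (N : ℕ) (a : ℕ → ℂ) (T : ℝ) (𝒯 : Finset ℝ), 1 ≤ N → 1 ≤ T →
      (∀ t ∈ 𝒯, |t| ≤ T) → (∀ t ∈ 𝒯, ∀ t' ∈ 𝒯, t ≠ t' → 1 ≤ |t - t'|) →
      ∑ t ∈ 𝒯, ‖∑ n ∈ Finset.Icc 1 N, a n * (n : ℂ) ^ (-((t : ℂ) * Complex.I))‖ ^ 2 ≤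
        C₉ * (N + (Finset.card 𝒯 : ℕ) * Real.sqrt T) * Real.log (2 * T) * ∑ n ∈ Finset.Icc 1 N, ‖a n‖ ^ 2)) (hη : 0 < η) (hη6 : η < 1 / 6)
    {f : ℕ → ℝ} (hf1 : ∀ n, |f n| ≤ 1) (c : ℕ → ℂ) (hXe : Real.exp 1 ≤ X)
    (c2 : 2 ≤ Real.log X ^ (1 / 50 : ℝ)) (c3 : 40 * Real.log X ^ (99 / 100 : ℝ) ≤ Real.log X)
    (c4 : Real.log X ^ (1 / 14 : ℝ) * Real.sqrt (Real.log X) *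
      Real.exp (2 / 3 * Real.sqrt (Real.log X) + Real.log X ^ (99 / 100 : ℝ) - 2 * η * Real.log X) ≤ 1)
    {T₀ T : ℝ} (hT₀ : 0 ≤ T₀) (hXT : X ^ (1 / 4 : ℝ) ≤ T) (hTX : T ≤ X) (hH1 : 2 ≤ I.Hpar 1) {v : ℕ}
    (hv : v ∈ Icc ⌊Real.log X ^ (1 / 50 : ℝ) * Real.log (Real.exp (Real.log X ^ (97 / 100 : ℝ)))⌋₊
      ⌊Real.log X ^ (1 / 50 : ℝ) * Real.log (Real.exp (Real.log X ^ (99 / 100 : ℝ)))⌋₊)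
    (𝒯 : Finset ℝ) (h𝒯 : ∀ t ∈ 𝒯, t ∈ Set.Icc T₀ T) (hws : ∀ t ∈ 𝒯, ∀ t' ∈ 𝒯, t ≠ t' → 1 ≤ |t - t'|)
    (hcard : (#𝒯 : ℝ) ≤ #(I.blocks I.J) * (C₈ * Real.exp (Real.sqrt (Real.log X) / 2) * X ^ (1 / 2 - 2 * η : ℝ))) :
    ∑ t ∈ 𝒯.filter (fun t => ‖blockPrimePoly c (Real.exp (Real.log X ^ (97 / 100 : ℝ)))
        (Real.exp (Real.log X ^ (99 / 100 : ℝ))) (Real.log X ^ (1 / 50 : ℝ)) v t‖ < (Real.log X ^ 100)⁻¹),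
      ‖blockPrimePoly c (Real.exp (Real.log X ^ (97 / 100 : ℝ))) (Real.exp (Real.log X ^ (99 / 100 : ℝ)))
          (Real.log X ^ (1 / 50 : ℝ)) v t *
        blockCofactorPoly (I.aCoef f) X (Real.exp (Real.log X ^ (97 / 100 : ℝ)))
          (Real.exp (Real.log X ^ (99 / 100 : ℝ))) (Real.log X ^ (1 / 50 : ℝ)) v t‖ ^ 2 ≤
      2 * C₉ * (4 + 4 ^ 20 * C₈) * Real.log X * ((Real.log X ^ 100) ^ 2)⁻¹ := by
  classical
  have hη' : η ≤ 8 := by linarith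
  set L := Real.log X with hLdef
  set H := L ^ (1 / 50 : ℝ) with hHdef
  have hX0 : 0 < X := (Real.exp_pos 1).trans_le hXe
  have hL1 : 1 ≤ L := by rw [hLdef, ← Real.log_exp 1]; exact Real.log_le_log (Real.exp_pos 1) hXe
  have hL0 : 0 < L := by linarith
  obtain ⟨hL400, h40, hL99, hL97, h97, h9799⟩ := MatomakiRadziwillU.Lfacts hL1 c2 c3
  rw [Real.log_exp, Real.log_exp] at hv
  have hH2 : 2 ≤ H := c2
  have hH0 : 0 < H := by linarith
  obtain ⟨hx1, hx2⟩ := MatomakiRadziwillU.div_mem_of_mem_Icc hH0 (Real.rpow_nonneg hL0.le _) hv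
  have hX : X = Real.exp L := by rw [hLdef, Real.exp_log hX0]
  -- `X' = X e^{-x} = e^{L-x} ≥ 1`, `T ≥ 1`
  have hX'eq : X * Real.exp (-((v : ℝ) / H)) = Real.exp (L - v / H) := by rw [hX, ← Real.exp_add]; ring_nf
  have hX'1 : 1 ≤ X * Real.exp (-((v : ℝ) / H)) := by
    rw [hX'eq]
    refine Real.one_le_exp ?_
    have : L ^ (99 / 100 : ℝ) ≤ L / 40 := by linarith
    linarith
  have hXrpow : ∀ y : ℝ, X ^ y = Real.exp (L * y) := fun y => Real.rpow_def_of_pos hX0 y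
  have hT4 : Real.exp (L / 4) ≤ T := by rw [hXrpow] at hXT; convert hXT using 2; ring
  have hT1 : 1 ≤ T := by have := Real.add_one_le_exp (L / 4); linarith
  have hT0 : 0 < T := by linarith
  have habs : ∀ t ∈ 𝒯, |t| ≤ T := fun t ht => by
    have h := h𝒯 t ht
    rw [abs_of_nonneg (hT₀.trans h.1)]; exact h.2
  have hlog2T : Real.log (2 * T) ≤ 2 * L := by
    have h1 : Real.log (2 * T) ≤ Real.log (2 * X) := Real.log_le_log (by linarith) (by linarith)
    rw [Real.log_mul two_ne_zero hX0.ne'] at h1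
    have h2 : Real.log 2 < 1 := by
      rw [← Real.log_exp 1]
      exact Real.log_lt_log two_pos (by linarith [Real.exp_one_gt_d9])
    linarith
  have hlog2T0 : 0 ≤ Real.log (2 * T) := Real.log_nonneg (by linarith)
  have hsqrtT : Real.sqrt T ≤ Real.exp (L / 2) := by
    rw [show Real.exp (L / 2) = Real.sqrt (Real.exp L) by rw [← Real.exp_half]]
    exact Real.sqrt_le_sqrt (by rw [← hX]; exact hTX)
  rw [hXrpow] at hcard
  have hIJ := I.card_blocks_J_le hη hη6 hL1 (by linarith)
  -- Lemma 9 for `R_{v,H}` and the `𝒯_S`-step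
  have hB : 0 < L ^ 100 := by positivity
  refine (MatomakiRadziwillU.sum_filter_small_le _ _ hB 𝒯).trans ?_
  have hR := MatomakiRadziwillU.sum_norm_sq_cofactor_le hC₉ h9 (I.norm_aCoef_le hf1) X
    (Real.exp (L ^ (97 / 100 : ℝ))) (Real.exp (L ^ (99 / 100 : ℝ))) H v hX'1 hT1 𝒯 habs hws
  rw [mul_comm]
  refine mul_le_mul_of_nonneg_right (hR.trans ?_) (by positivity)
  exact TS_numeric hC₈ hC₉ hX'eq hx2 hsqrtT (Real.sqrt_nonneg _) (Nat.cast_nonneg _)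
    hcard hIJ c4 hlog2T hlog2T0

/-! ### One block `v`: `∑_{t ∈ 𝒯} |Q_{v,H} R_{v,H}|² ≤ 𝒯_S-bound + (sup |R_{v,H}|)² · 𝒯_L-bound` -/

set_option maxHeartbeats 400000 in
/-- **The sum over one well-spaced set** (§8.3, `𝒯 = 𝒯_S ∪ 𝒯_L`): under the size conditions, for `X^{1/4} ≤ T ≤ X`,
`H₁ ≥ 2`, a `1`-spaced `𝒯 ⊂ [(log X)^{1/15}, T]` with the point count of `card_witness_le`, and a block `v`,
`∑_{t ∈ 𝒯} |Q_{v,H} R_{v,H}|²(t) ≤ 2C₉(4 + 4^20 C₈) L·L^{-200} + (2^J 3C₃ L^{1/50-1/16})² · 24 C₁₁ C (1+C₈)/(H (L^{97/100})²)`.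
[cite: MatomakiRadziwillAnnals2016, §8.3] -/
theorem sum_block_le {C₃ C₈ C₉ C₁₁ C : ℝ} (hC₃ : 0 ≤ C₃) (h3 : (∀ f : ArithmeticFunction ℝ, f.IsMultiplicative → (∀ n, |f n| ≤ 1) →
      ∀ X P Q t : ℝ, 2 ≤ P → P ≤ Q → Q ≤ X → Real.log X ^ (1 / 16 : ℝ) ≤ t → t ≤ X ^ (2 : ℝ) →
        ‖∑ n ∈ Finset.Icc ⌈X⌉₊ ⌊2 * X⌋₊,
            (f n : ℂ) * (n : ℂ) ^ (-(1 + (t : ℂ) * Complex.I)) / ((primeDivisorsIn P Q n : ℂ) + 1)‖ ≤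
          C₃ * (Real.log Q / (Real.log X ^ (1 / 16 : ℝ) * Real.log P)
            + Real.log X * Real.exp (-(Real.log X / (3 * Real.log Q)) * Real.log (Real.log X / Real.log Q))))) (hC₈ : 0 ≤ C₈)
    (h8 : (∀ (P T V : ℝ) (a : ℕ → ℂ) (𝒯 : Finset ℝ), 2 ≤ P → P ^ 2 ≤ T →
      Real.exp (Real.exp 4) ≤ T → 1 ≤ V → (∀ p, ‖a p‖ ≤ 1) → (∀ t ∈ 𝒯, |t| ≤ T) →
      (∀ t ∈ 𝒯, ∀ t' ∈ 𝒯, t ≠ t' → 1 ≤ |t - t'|) →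
      (∀ t ∈ 𝒯, V⁻¹ ≤ ‖∑ p ∈ (Finset.Icc ⌈P⌉₊ ⌊2 * P⌋₊).filter Nat.Prime,
          a p * (p : ℂ) ^ (-(1 + (t : ℂ) * Complex.I))‖) →
      ((Finset.card 𝒯 : ℕ) : ℝ) ≤ C₈ * V ^ 2 * T ^ (2 * Real.log V / Real.log P)
        * Real.exp (4 * (Real.log T / Real.log P) * Real.log (Real.log T)))) (hC₉ : 0 ≤ C₉) (h9 : (∀ (N : ℕ) (a : ℕ → ℂ) (T : ℝ) (𝒯 : Finset ℝ), 1 ≤ N → 1 ≤ T →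
      (∀ t ∈ 𝒯, |t| ≤ T) → (∀ t ∈ 𝒯, ∀ t' ∈ 𝒯, t ≠ t' → 1 ≤ |t - t'|) →
      ∑ t ∈ 𝒯, ‖∑ n ∈ Finset.Icc 1 N, a n * (n : ℂ) ^ (-((t : ℂ) * Complex.I))‖ ^ 2 ≤
        C₉ * (N + (Finset.card 𝒯 : ℕ) * Real.sqrt T) * Real.log (2 * T) * ∑ n ∈ Finset.Icc 1 N, ‖a n‖ ^ 2)) (hC₁₁ : 0 ≤ C₁₁) (h11 : (∀ (P T : ℝ) (a : ℕ → ℂ) (𝒯 : Finset ℝ), 2 ≤ P → 2 ≤ T →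
      (∀ t ∈ 𝒯, |t| ≤ T) → (∀ t ∈ 𝒯, ∀ t' ∈ 𝒯, t ≠ t' → 1 ≤ |t - t'|) →
      ∑ t ∈ 𝒯, ‖∑ p ∈ (Finset.Icc ⌈P⌉₊ ⌊2 * P⌋₊).filter Nat.Prime,
          a p * (p : ℂ) ^ (-((t : ℂ) * Complex.I))‖ ^ 2 ≤
        C₁₁ * (P + ((Finset.card 𝒯 : ℕ) : ℝ) * P * Real.exp (-(Real.log P / Real.log T ^ (2 / 3 + 1 / 10 : ℝ)))
            * Real.log T ^ 2)
          * ∑ p ∈ (Finset.Icc ⌈P⌉₊ ⌊2 * P⌋₊).filter Nat.Prime, ‖a p‖ ^ 2 / Real.log P))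
    (hC : 0 ≤ C) (hBT : ∀ N M : ℕ, 2 ≤ M → (#((Ioc N (N + M)).filter Nat.Prime) : ℝ) ≤ C * M / Real.log M)
    (hη : 0 < η) (hη6 : η < 1 / 6) (f : ArithmeticFunction ℝ) (hf : f.IsMultiplicative) (hf1 : ∀ n, |f n| ≤ 1)
    (hXe : Real.exp 1 ≤ X) (c2 : 2 ≤ Real.log X ^ (1 / 50 : ℝ)) (c3 : 40 * Real.log X ^ (99 / 100 : ℝ) ≤ Real.log X)
    (c4 : Real.log X ^ (1 / 14 : ℝ) * Real.sqrt (Real.log X) *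
      Real.exp (2 / 3 * Real.sqrt (Real.log X) + Real.log X ^ (99 / 100 : ℝ) - 2 * η * Real.log X) ≤ 1)
    (c5 : Real.log X * Real.exp (-(Real.log X ^ (1 / 100 : ℝ) / 6)) ≤ Real.log X ^ (1 / 50 - 1 / 16 : ℝ))
    (c6 : Real.log X ^ 202 * Real.exp (408 * Real.log X ^ (3 / 100 : ℝ) * Real.log (Real.log X)
      - Real.log X ^ (61 / 300 : ℝ) / 2) ≤ 1)
    (c7 : 4 * Real.log X ≤ Real.exp (Real.log X ^ (97 / 100 : ℝ) / 2))
    {T : ℝ} (hXT : X ^ (1 / 4 : ℝ) ≤ T) (hTX : T ≤ X) (hH1 : 2 ≤ I.Hpar 1) {v : ℕ} (hv : v ∈ (Icc ⌊Real.log X ^ (1 / 50 : ℝ) * Real.log (Real.exp (Real.log X ^ (97 / 100 : ℝ)))⌋₊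
      ⌊Real.log X ^ (1 / 50 : ℝ) * Real.log (Real.exp (Real.log X ^ (99 / 100 : ℝ)))⌋₊))
    (𝒯 : Finset ℝ)
    (h𝒯 : ∀ t ∈ 𝒯, t ∈ Set.Icc (Real.log X ^ (1 / 15 : ℝ)) T ∧ ∃ v ∈ I.blocks I.J,
      Real.exp (-(alpha η I.J * v / I.Hpar I.J)) ≤
        ‖blockPrimePoly (fun p => ((f p : ℝ) : ℂ)) (I.P I.J) (I.Q I.J) (I.Hpar I.J) v t‖)
    (hws : ∀ t ∈ 𝒯, ∀ t' ∈ 𝒯, t ≠ t' → 1 ≤ |t - t'|) :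
    ∑ t ∈ 𝒯, ‖(blockPrimePoly (fun p => ((f p : ℝ) : ℂ)) (Real.exp (Real.log X ^ (97 / 100 : ℝ))) (Real.exp (Real.log X ^ (99 / 100 : ℝ)))
          (Real.log X ^ (1 / 50 : ℝ)) v t) *
        blockCofactorPoly (I.aCoef f) X (Real.exp (Real.log X ^ (97 / 100 : ℝ)))
          (Real.exp (Real.log X ^ (99 / 100 : ℝ))) (Real.log X ^ (1 / 50 : ℝ)) v t‖ ^ 2 ≤
      2 * C₉ * (4 + 4 ^ 20 * C₈) * Real.log X * ((Real.log X ^ 100) ^ 2)⁻¹ +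
        (2 ^ I.J * (3 * C₃ * Real.log X ^ (1 / 50 - 1 / 16 : ℝ))) ^ 2 *
          (24 * C₁₁ * C * (1 + C₈) / (Real.log X ^ (1 / 50 : ℝ) * (Real.log X ^ (97 / 100 : ℝ)) ^ 2)) := by
  classical
  have hL1 : 1 ≤ Real.log X := by rw [← Real.log_exp 1]; exact Real.log_le_log (Real.exp_pos 1) hXe
  have hL400 := (MatomakiRadziwillU.Lfacts hL1 c2 c3).1
  have hT₀ : 0 ≤ Real.log X ^ (1 / 15 : ℝ) := Real.rpow_nonneg (by linarith) _
  have hc : ∀ p, ‖((f p : ℝ) : ℂ)‖ ≤ 1 := norm_cCoef_le hf1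
  have h𝒯' : ∀ t ∈ 𝒯, t ∈ Set.Icc (Real.log X ^ (1 / 15 : ℝ)) T := fun t ht => (h𝒯 t ht).1
  have hcard := I.card_witness_le hC₈ h8 hη hη6 hc hXe hL400 hT₀ hXT hTX hH1 𝒯 h𝒯 hws
  rw [← sum_filter_add_sum_filter_not 𝒯 (fun t => ‖(blockPrimePoly (fun p => ((f p : ℝ) : ℂ)) (Real.exp (Real.log X ^ (97 / 100 : ℝ))) (Real.exp (Real.log X ^ (99 / 100 : ℝ)))
          (Real.log X ^ (1 / 50 : ℝ)) v t)‖ < (Real.log X ^ 100)⁻¹)]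
  refine add_le_add ?_ ?_
  · exact I.TS_sum_le hC₈ hC₉ h9 hη hη6 hf1 _ hXe c2 c3 c4 hT₀ hXT hTX hH1 hv 𝒯 h𝒯' hws hcard
  · rw [Finset.filter_congr (fun t _ => not_lt)]
    have hR : ∀ t ∈ 𝒯.filter (fun t => (Real.log X ^ 100)⁻¹ ≤ ‖(blockPrimePoly (fun p => ((f p : ℝ) : ℂ)) (Real.exp (Real.log X ^ (97 / 100 : ℝ))) (Real.exp (Real.log X ^ (99 / 100 : ℝ)))
          (Real.log X ^ (1 / 50 : ℝ)) v t)‖),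
        ‖(blockPrimePoly (fun p => ((f p : ℝ) : ℂ)) (Real.exp (Real.log X ^ (97 / 100 : ℝ))) (Real.exp (Real.log X ^ (99 / 100 : ℝ)))
          (Real.log X ^ (1 / 50 : ℝ)) v t) *
          blockCofactorPoly (I.aCoef f) X (Real.exp (Real.log X ^ (97 / 100 : ℝ)))
            (Real.exp (Real.log X ^ (99 / 100 : ℝ))) (Real.log X ^ (1 / 50 : ℝ)) v t‖ ^ 2 ≤
        (2 ^ I.J * (3 * C₃ * Real.log X ^ (1 / 50 - 1 / 16 : ℝ))) ^ 2 *
          ‖(blockPrimePoly (fun p => ((f p : ℝ) : ℂ)) (Real.exp (Real.log X ^ (97 / 100 : ℝ))) (Real.exp (Real.log X ^ (99 / 100 : ℝ)))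
          (Real.log X ^ (1 / 50 : ℝ)) v t)‖ ^ 2 := by
      intro t ht
      have ht' := h𝒯' t (mem_filter.1 ht).1
      have hb := I.norm_blockCofactorPoly_le hC₃ h3 f hf hf1 hXe c2 c3 c5 hTX ht' hv
      rw [norm_mul, mul_pow, mul_comm]
      exact mul_le_mul_of_nonneg_right (pow_le_pow_left₀ (norm_nonneg _) hb 2) (by positivity)
    refine (sum_le_sum hR).trans ?_
    rw [← mul_sum]
    refine mul_le_mul_of_nonneg_left ?_ (by positivity)
    exact MatomakiRadziwillU.TL_sum_sq_le hC₈ h8 hC₁₁ h11 hC hBT hc hXe c2 c3 c6 c7 hT₀ hXT hTX hv 𝒯 h𝒯' hws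

set_option maxHeartbeats 400000 in
/-- **All blocks** (§8.3): with `PV` the bound of `sum_block_le`,
`∑_{v ∈ ℐ} ∫_𝒰 |Q_{v,H} R_{v,H}|² dt ≤ #ℐ · 2 PV` (discretisation into `𝒯₀ ∪ 𝒯₁`, then `sum_block_le` for each).
[cite: MatomakiRadziwillAnnals2016, §8.3] -/
theorem sum_blocks_integral_le {C₃ C₈ C₉ C₁₁ C : ℝ} (hC₃ : 0 ≤ C₃) (h3 : (∀ f : ArithmeticFunction ℝ, f.IsMultiplicative → (∀ n, |f n| ≤ 1) →
      ∀ X P Q t : ℝ, 2 ≤ P → P ≤ Q → Q ≤ X → Real.log X ^ (1 / 16 : ℝ) ≤ t → t ≤ X ^ (2 : ℝ) →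
        ‖∑ n ∈ Finset.Icc ⌈X⌉₊ ⌊2 * X⌋₊,
            (f n : ℂ) * (n : ℂ) ^ (-(1 + (t : ℂ) * Complex.I)) / ((primeDivisorsIn P Q n : ℂ) + 1)‖ ≤
          C₃ * (Real.log Q / (Real.log X ^ (1 / 16 : ℝ) * Real.log P)
            + Real.log X * Real.exp (-(Real.log X / (3 * Real.log Q)) * Real.log (Real.log X / Real.log Q))))) (hC₈ : 0 ≤ C₈)
    (h8 : (∀ (P T V : ℝ) (a : ℕ → ℂ) (𝒯 : Finset ℝ), 2 ≤ P → P ^ 2 ≤ T →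
      Real.exp (Real.exp 4) ≤ T → 1 ≤ V → (∀ p, ‖a p‖ ≤ 1) → (∀ t ∈ 𝒯, |t| ≤ T) →
      (∀ t ∈ 𝒯, ∀ t' ∈ 𝒯, t ≠ t' → 1 ≤ |t - t'|) →
      (∀ t ∈ 𝒯, V⁻¹ ≤ ‖∑ p ∈ (Finset.Icc ⌈P⌉₊ ⌊2 * P⌋₊).filter Nat.Prime,
          a p * (p : ℂ) ^ (-(1 + (t : ℂ) * Complex.I))‖) →
      ((Finset.card 𝒯 : ℕ) : ℝ) ≤ C₈ * V ^ 2 * T ^ (2 * Real.log V / Real.log P)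
        * Real.exp (4 * (Real.log T / Real.log P) * Real.log (Real.log T)))) (hC₉ : 0 ≤ C₉) (h9 : (∀ (N : ℕ) (a : ℕ → ℂ) (T : ℝ) (𝒯 : Finset ℝ), 1 ≤ N → 1 ≤ T →
      (∀ t ∈ 𝒯, |t| ≤ T) → (∀ t ∈ 𝒯, ∀ t' ∈ 𝒯, t ≠ t' → 1 ≤ |t - t'|) →
      ∑ t ∈ 𝒯, ‖∑ n ∈ Finset.Icc 1 N, a n * (n : ℂ) ^ (-((t : ℂ) * Complex.I))‖ ^ 2 ≤
        C₉ * (N + (Finset.card 𝒯 : ℕ) * Real.sqrt T) * Real.log (2 * T) * ∑ n ∈ Finset.Icc 1 N, ‖a n‖ ^ 2)) (hC₁₁ : 0 ≤ C₁₁) (h11 : (∀ (P T : ℝ) (a : ℕ → ℂ) (𝒯 : Finset ℝ), 2 ≤ P → 2 ≤ T →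
      (∀ t ∈ 𝒯, |t| ≤ T) → (∀ t ∈ 𝒯, ∀ t' ∈ 𝒯, t ≠ t' → 1 ≤ |t - t'|) →
      ∑ t ∈ 𝒯, ‖∑ p ∈ (Finset.Icc ⌈P⌉₊ ⌊2 * P⌋₊).filter Nat.Prime,
          a p * (p : ℂ) ^ (-((t : ℂ) * Complex.I))‖ ^ 2 ≤
        C₁₁ * (P + ((Finset.card 𝒯 : ℕ) : ℝ) * P * Real.exp (-(Real.log P / Real.log T ^ (2 / 3 + 1 / 10 : ℝ)))
            * Real.log T ^ 2)
          * ∑ p ∈ (Finset.Icc ⌈P⌉₊ ⌊2 * P⌋₊).filter Nat.Prime, ‖a p‖ ^ 2 / Real.log P))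
    (hC : 0 ≤ C) (hBT : ∀ N M : ℕ, 2 ≤ M → (#((Ioc N (N + M)).filter Nat.Prime) : ℝ) ≤ C * M / Real.log M)
    (hη : 0 < η) (hη6 : η < 1 / 6) (f : ArithmeticFunction ℝ) (hf : f.IsMultiplicative) (hf1 : ∀ n, |f n| ≤ 1)
    (hXe : Real.exp 1 ≤ X) (c2 : 2 ≤ Real.log X ^ (1 / 50 : ℝ)) (c3 : 40 * Real.log X ^ (99 / 100 : ℝ) ≤ Real.log X)
    (c4 : Real.log X ^ (1 / 14 : ℝ) * Real.sqrt (Real.log X) *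
      Real.exp (2 / 3 * Real.sqrt (Real.log X) + Real.log X ^ (99 / 100 : ℝ) - 2 * η * Real.log X) ≤ 1)
    (c5 : Real.log X * Real.exp (-(Real.log X ^ (1 / 100 : ℝ) / 6)) ≤ Real.log X ^ (1 / 50 - 1 / 16 : ℝ))
    (c6 : Real.log X ^ 202 * Real.exp (408 * Real.log X ^ (3 / 100 : ℝ) * Real.log (Real.log X)
      - Real.log X ^ (61 / 300 : ℝ) / 2) ≤ 1)
    (c7 : 4 * Real.log X ≤ Real.exp (Real.log X ^ (97 / 100 : ℝ) / 2))
    {T : ℝ} (hXT : X ^ (1 / 4 : ℝ) ≤ T) (hTX : T ≤ X) (hH1 : 2 ≤ I.Hpar 1) :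
    ∑ v ∈ (Icc ⌊Real.log X ^ (1 / 50 : ℝ) * Real.log (Real.exp (Real.log X ^ (97 / 100 : ℝ)))⌋₊
      ⌊Real.log X ^ (1 / 50 : ℝ) * Real.log (Real.exp (Real.log X ^ (99 / 100 : ℝ)))⌋₊), ∫ t in I.Uset (fun p => ((f p : ℝ) : ℂ)) (Real.log X ^ (1 / 15 : ℝ)) T,
        ‖(blockPrimePoly (fun p => ((f p : ℝ) : ℂ)) (Real.exp (Real.log X ^ (97 / 100 : ℝ))) (Real.exp (Real.log X ^ (99 / 100 : ℝ)))
          (Real.log X ^ (1 / 50 : ℝ)) v t) *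
          blockCofactorPoly (I.aCoef f) X (Real.exp (Real.log X ^ (97 / 100 : ℝ)))
            (Real.exp (Real.log X ^ (99 / 100 : ℝ))) (Real.log X ^ (1 / 50 : ℝ)) v t‖ ^ 2 ≤
      #((Icc ⌊Real.log X ^ (1 / 50 : ℝ) * Real.log (Real.exp (Real.log X ^ (97 / 100 : ℝ)))⌋₊
      ⌊Real.log X ^ (1 / 50 : ℝ) * Real.log (Real.exp (Real.log X ^ (99 / 100 : ℝ)))⌋₊)) * (2 * (2 * C₉ * (4 + 4 ^ 20 * C₈) * Real.log X * ((Real.log X ^ 100) ^ 2)⁻¹ +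
        (2 ^ I.J * (3 * C₃ * Real.log X ^ (1 / 50 - 1 / 16 : ℝ))) ^ 2 *
          (24 * C₁₁ * C * (1 + C₈) / (Real.log X ^ (1 / 50 : ℝ) * (Real.log X ^ (97 / 100 : ℝ)) ^ 2)))) := by
  classical
  have hL1 : 1 ≤ Real.log X := by rw [← Real.log_exp 1]; exact Real.log_le_log (Real.exp_pos 1) hXe
  have hT₀ : 0 ≤ Real.log X ^ (1 / 15 : ℝ) := Real.rpow_nonneg (by linarith) _
  rw [← nsmul_eq_mul, ← sum_const]
  refine sum_le_sum fun v hv => ?_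
  -- discretise
  set g : ℝ → ℝ := fun t => ‖(blockPrimePoly (fun p => ((f p : ℝ) : ℂ)) (Real.exp (Real.log X ^ (97 / 100 : ℝ))) (Real.exp (Real.log X ^ (99 / 100 : ℝ)))
          (Real.log X ^ (1 / 50 : ℝ)) v t) *
      blockCofactorPoly (I.aCoef f) X (Real.exp (Real.log X ^ (97 / 100 : ℝ)))
        (Real.exp (Real.log X ^ (99 / 100 : ℝ))) (Real.log X ^ (1 / 50 : ℝ)) v t‖ ^ 2 with hg
  have hcQ : Continuous fun t : ℝ => (blockPrimePoly (fun p => ((f p : ℝ) : ℂ)) (Real.exp (Real.log X ^ (97 / 100 : ℝ))) (Real.exp (Real.log X ^ (99 / 100 : ℝ)))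
          (Real.log X ^ (1 / 50 : ℝ)) v t) := by
    unfold blockPrimePoly; exact MatomakiRadziwillLemma12.continuous_dsum _ _
  have hcR : Continuous fun t : ℝ => blockCofactorPoly (I.aCoef f) X (Real.exp (Real.log X ^ (97 / 100 : ℝ)))
      (Real.exp (Real.log X ^ (99 / 100 : ℝ))) (Real.log X ^ (1 / 50 : ℝ)) v t := by
    unfold blockCofactorPoly
    exact continuous_finsetSum _ fun m _ =>
      (continuous_const.mul (MatomakiRadziwillLemma12.continuous_cpw m)).div_const _
  have hgc : Continuous g := ((hcQ.mul hcR).norm).pow 2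
  have hg0 : ∀ t, 0 ≤ g t := fun t => by rw [hg]; positivity
  obtain ⟨𝒯, hprop, hws, hint⟩ := I.Uset_discretisation (fun p => ((f p : ℝ) : ℂ)) hT₀ hgc hg0 (T := T)
  refine hint.trans ?_
  rw [Fin.sum_univ_two, two_mul]
  have hprop' : ∀ i, ∀ t ∈ 𝒯 i, t ∈ Set.Icc (Real.log X ^ (1 / 15 : ℝ)) T ∧ ∃ v ∈ I.blocks I.J,
      Real.exp (-(alpha η I.J * v / I.Hpar I.J)) ≤
        ‖blockPrimePoly (fun p => ((f p : ℝ) : ℂ)) (I.P I.J) (I.Q I.J) (I.Hpar I.J) v t‖ :=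
    fun i t ht => ⟨(hprop i t ht).1, (hprop i t ht).2 I.J (mem_Icc.2 ⟨I.one_le_J, le_rfl⟩)⟩
  refine add_le_add ?_ ?_ <;>
    exact I.sum_block_le hC₃ h3 hC₈ h8 hC₉ h9 hC₁₁ h11 hC hBT hη hη6 f hf hf1 hXe c2 c3 c4 c5 c6 c7 hXT hTX
      hH1 hv _ (hprop' _) (hws _)

end SieveIntervalSystem

namespace MatomakiRadziwillU

/-! ### The numerical bookkeeping of §8.3 -/

/-- `L^{101/100} L^{101/100} L · L^{-200} ≤ L^{-1/50}` (`L ≥ 1`). [folklore] -/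
theorem rpow_bookkeeping_S {L : ℝ} (hL1 : 1 ≤ L) :
    L ^ (101 / 100 : ℝ) * L ^ (101 / 100 : ℝ) * L * ((L ^ 100) ^ 2)⁻¹ ≤ L ^ (-(1 / 50) : ℝ) := by
  have hL0 : 0 < L := by linarith
  rw [← pow_mul, show L ^ (101 / 100 : ℝ) * L ^ (101 / 100 : ℝ) * L * (L ^ (100 * 2))⁻¹ =
    L ^ (101 / 100 : ℝ) * L ^ (101 / 100 : ℝ) * L / L ^ (100 * 2) by ring, div_le_iff₀ (by positivity),
    ← Real.rpow_add hL0, ← Real.rpow_add_one hL0.ne', ← Real.rpow_add_natCast hL0.ne']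
  exact Real.rpow_le_rpow_of_exponent_le hL1 (by norm_num)

/-- `L^{101/100} L^{101/100} (L^{1/50-1/16})² / (L^{1/50} (L^{97/100})²) = L^{-1/40}` (`L > 0`). [folklore] -/
theorem rpow_bookkeeping_L {L : ℝ} (hL0 : 0 < L) :
    L ^ (101 / 100 : ℝ) * L ^ (101 / 100 : ℝ) * (L ^ (1 / 50 - 1 / 16 : ℝ)) ^ 2 /
      (L ^ (1 / 50 : ℝ) * (L ^ (97 / 100 : ℝ)) ^ 2) = L ^ (-(1 / 40) : ℝ) := by
  rw [← Real.rpow_mul_natCast hL0.le, ← Real.rpow_mul_natCast hL0.le, ← Real.rpow_add hL0,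
    ← Real.rpow_add hL0, ← Real.rpow_add hL0, ← Real.rpow_sub hL0]
  norm_num

/-- **The main term of §8.3, numerically**: with `A = H log(Q/P) ∈ [0, L^{101/100}]`, `#ℐ ≤ A + 2`, `L^{101/100} ≥ 2`
and `∑_v ∫_𝒰 |Q_v R_v|² ≤ #ℐ · 2(TS + SR² TL)` (the bounds of `sum_blocks_integral_le`):
`20000 A ∑_v ∫ ≤ 160000 C₉ (4 + 4^20 C₈) L^{-1/50} + 17280000 C₃² C₁₁ C (1+C₈) 4^J L^{-1/40}`. [folklore] -/
theorem main_numeric {L A NU Ssum C₃ C₈ C₉ C₁₁ C : ℝ} {J : ℕ} (hL1 : 1 ≤ L) (hL2 : 2 ≤ L ^ (101 / 100 : ℝ))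
    (hC₈ : 0 ≤ C₈) (hC₉ : 0 ≤ C₉) (hC₁₁ : 0 ≤ C₁₁) (hC : 0 ≤ C)
    (hA0 : 0 ≤ A) (hA : A ≤ L ^ (101 / 100 : ℝ)) (hNU : NU ≤ A + 2)
    (hS : Ssum ≤ NU * (2 * (2 * C₉ * (4 + 4 ^ 20 * C₈) * L * ((L ^ 100) ^ 2)⁻¹ +
      (2 ^ J * (3 * C₃ * L ^ (1 / 50 - 1 / 16 : ℝ))) ^ 2 *
        (24 * C₁₁ * C * (1 + C₈) / (L ^ (1 / 50 : ℝ) * (L ^ (97 / 100 : ℝ)) ^ 2))))) :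
    20000 * (A * Ssum) ≤ 160000 * C₉ * (4 + 4 ^ 20 * C₈) * L ^ (-(1 / 50) : ℝ) +
      17280000 * C₃ ^ 2 * C₁₁ * C * (1 + C₈) * 4 ^ J * L ^ (-(1 / 40) : ℝ) := by
  have hL0 : 0 < L := by linarith
  set TS := 2 * C₉ * (4 + 4 ^ 20 * C₈) * L * ((L ^ 100) ^ 2)⁻¹ with hTS
  set TL := (2 ^ J * (3 * C₃ * L ^ (1 / 50 - 1 / 16 : ℝ))) ^ 2 *
    (24 * C₁₁ * C * (1 + C₈) / (L ^ (1 / 50 : ℝ) * (L ^ (97 / 100 : ℝ)) ^ 2)) with hTL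
  have hPV0 : 0 ≤ 2 * (TS + TL) := by positivity
  have h1 : A * Ssum ≤ L ^ (101 / 100 : ℝ) * ((L ^ (101 / 100 : ℝ) + 2) * (2 * (TS + TL))) := by
    have hS2 : Ssum ≤ (A + 2) * (2 * (TS + TL)) := hS.trans (mul_le_mul_of_nonneg_right hNU hPV0)
    calc A * Ssum ≤ A * ((A + 2) * (2 * (TS + TL))) := mul_le_mul_of_nonneg_left hS2 hA0
      _ ≤ L ^ (101 / 100 : ℝ) * ((L ^ (101 / 100 : ℝ) + 2) * (2 * (TS + TL))) :=
          mul_le_mul hA (mul_le_mul_of_nonneg_right (by linarith) hPV0) (mul_nonneg (by linarith) hPV0)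
            (by positivity)
  have h2 : L ^ (101 / 100 : ℝ) * ((L ^ (101 / 100 : ℝ) + 2) * (2 * (TS + TL))) ≤
      L ^ (101 / 100 : ℝ) * ((2 * L ^ (101 / 100 : ℝ)) * (2 * (TS + TL))) :=
    mul_le_mul_of_nonneg_left (mul_le_mul_of_nonneg_right (by linarith) hPV0) (by positivity)
  have hS' := rpow_bookkeeping_S hL1
  have hL' := rpow_bookkeeping_L hL0
  have e1 : L ^ (101 / 100 : ℝ) * ((2 * L ^ (101 / 100 : ℝ)) * (2 * (TS + TL))) =
      4 * (2 * C₉ * (4 + 4 ^ 20 * C₈)) * (L ^ (101 / 100 : ℝ) * L ^ (101 / 100 : ℝ) * L * ((L ^ 100) ^ 2)⁻¹) +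
      4 * ((2 ^ J) ^ 2 * (9 * C₃ ^ 2) * (24 * C₁₁ * C * (1 + C₈))) *
        (L ^ (101 / 100 : ℝ) * L ^ (101 / 100 : ℝ) * (L ^ (1 / 50 - 1 / 16 : ℝ)) ^ 2 /
          (L ^ (1 / 50 : ℝ) * (L ^ (97 / 100 : ℝ)) ^ 2)) := by
    rw [hTS, hTL]; ring
  have e2 : ((2 : ℝ) ^ J) ^ 2 = 4 ^ J := by rw [← pow_mul, mul_comm, pow_mul]; norm_num
  rw [hL', e2] at e1
  have h3 : 4 * (2 * C₉ * (4 + 4 ^ 20 * C₈)) * (L ^ (101 / 100 : ℝ) * L ^ (101 / 100 : ℝ) * L * ((L ^ 100) ^ 2)⁻¹) ≤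
      4 * (2 * C₉ * (4 + 4 ^ 20 * C₈)) * L ^ (-(1 / 50) : ℝ) :=
    mul_le_mul_of_nonneg_left hS' (by positivity)
  have := h1.trans h2
  rw [e1] at this
  nlinarith [h3, this]

/-- `e^7 ≥ 1024`. [folklore] -/
theorem exp_seven_ge : (1024 : ℝ) ≤ Real.exp 7 := by
  have h := Real.exp_one_gt_d9
  have : Real.exp 7 = Real.exp 1 ^ 7 := by rw [← Real.exp_nat_mul]; norm_num
  rw [this]
  have h7 : (2.7182818283 : ℝ) ^ 7 ≤ Real.exp 1 ^ 7 := pow_le_pow_left₀ (by norm_num) h.le 7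
  have : (1024 : ℝ) ≤ (2.7182818283 : ℝ) ^ 7 := by norm_num
  linarith

/-- **The error terms of the second application of Lemma 12, numerically**: under `c2, c3, c5`,
`1/H + 1/P ≤ 2 L^{-1/50}` and `((X+1) e^{6/log P} (log P/log Q) + (Q+1)^{10})/X ≤ (2e⁶ + 1) L^{-1/50}`
(`H = L^{1/50}`, `P = e^{L^{97/100}}`, `Q = e^{L^{99/100}}`, `X = e^L`). [folklore] -/
theorem remainder_numeric {L X : ℝ} (hX : X = Real.exp L) (hL1 : 1 ≤ L) (c2 : 2 ≤ L ^ (1 / 50 : ℝ))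
    (c3 : 40 * L ^ (99 / 100 : ℝ) ≤ L) (c5 : L * Real.exp (-(L ^ (1 / 100 : ℝ) / 6)) ≤ L ^ (1 / 50 - 1 / 16 : ℝ)) :
    1 / L ^ (1 / 50 : ℝ) + 1 / Real.exp (L ^ (97 / 100 : ℝ)) ≤ 2 * L ^ (-(1 / 50) : ℝ) ∧
    ((X + 1) * (Real.exp (6 / Real.log (Real.exp (L ^ (97 / 100 : ℝ)))) *
        (Real.log (Real.exp (L ^ (97 / 100 : ℝ))) / Real.log (Real.exp (L ^ (99 / 100 : ℝ))))) +
      (Real.exp (L ^ (99 / 100 : ℝ)) + 1) ^ (10 : ℕ)) * (1 / X) ≤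
      (2 * Real.exp 6 + 1) * L ^ (-(1 / 50) : ℝ) := by
  subst hX
  have hL0 : 0 < L := by linarith
  obtain ⟨hL400, h40, hL99, hL97, h97, h9799⟩ := Lfacts hL1 c2 c3
  rw [Real.log_exp, Real.log_exp]
  have hH : 1 / L ^ (1 / 50 : ℝ) = L ^ (-(1 / 50) : ℝ) := by rw [Real.rpow_neg hL0.le, one_div]
  -- `e^{-L^{97/100}} ≤ e^{-L/2}·(nothing) ≤ e^{-L^{1/100}/6} ≤ L^{-1/50}/L ≤ L^{-1/50}`
  have hsmall : Real.exp (-(L ^ (1 / 100 : ℝ) / 6)) ≤ L ^ (-(1 / 50) : ℝ) := by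
    have h1 : Real.exp (-(L ^ (1 / 100 : ℝ) / 6)) ≤ L ^ (1 / 50 - 1 / 16 : ℝ) / L := by
      rw [le_div_iff₀ hL0, mul_comm]; exact c5
    refine h1.trans ?_
    rw [div_le_iff₀ hL0, ← Real.rpow_add_one hL0.ne']
    exact Real.rpow_le_rpow_of_exponent_le hL1 (by norm_num)
  have h01 : L ^ (1 / 100 : ℝ) ≤ L := by
    conv_rhs => rw [← Real.rpow_one L]
    exact Real.rpow_le_rpow_of_exponent_le hL1 (by norm_num)
  have hP : 1 / Real.exp (L ^ (97 / 100 : ℝ)) ≤ L ^ (-(1 / 50) : ℝ) := by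
    rw [one_div, ← Real.exp_neg]
    refine le_trans (Real.exp_le_exp.2 ?_) hsmall
    have : L ^ (1 / 100 : ℝ) ≤ L ^ (97 / 100 : ℝ) := Real.rpow_le_rpow_of_exponent_le hL1 (by norm_num)
    linarith
  refine ⟨by linarith, ?_⟩
  -- the sieve term
  have hX0 : 0 < Real.exp L := Real.exp_pos L
  have hratio : L ^ (97 / 100 : ℝ) / L ^ (99 / 100 : ℝ) = L ^ (-(1 / 50) : ℝ) := by
    rw [← Real.rpow_sub hL0]; norm_num
  have he6 : Real.exp (6 / L ^ (97 / 100 : ℝ)) ≤ Real.exp 6 := by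
    refine Real.exp_le_exp.2 ?_
    rw [div_le_iff₀ (by linarith)]; nlinarith
  have hX1 : (Real.exp L + 1) * (1 / Real.exp L) ≤ 2 := by
    rw [← div_eq_mul_one_div, div_le_iff₀ hX0]
    have : 1 ≤ Real.exp L := Real.one_le_exp hL0.le
    linarith
  -- `(Q+1)^{10}/X ≤ L^{-1/50}`
  have hQ : (Real.exp (L ^ (99 / 100 : ℝ)) + 1) ^ (10 : ℕ) * (1 / Real.exp L) ≤ L ^ (-(1 / 50) : ℝ) := by
    have hQ0 : 0 < Real.exp (L ^ (99 / 100 : ℝ)) := Real.exp_pos _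
    have h1 : (Real.exp (L ^ (99 / 100 : ℝ)) + 1) ^ (10 : ℕ) ≤ (2 * Real.exp (L ^ (99 / 100 : ℝ))) ^ (10 : ℕ) := by
      refine pow_le_pow_left₀ (by positivity) ?_ 10
      have : 1 ≤ Real.exp (L ^ (99 / 100 : ℝ)) := Real.one_le_exp (by positivity)
      linarith
    have h2 : (2 * Real.exp (L ^ (99 / 100 : ℝ))) ^ (10 : ℕ) ≤ Real.exp (L / 2) := by
      rw [mul_pow, ← Real.exp_nat_mul]
      have h1024 : (2 : ℝ) ^ (10 : ℕ) ≤ Real.exp 7 := by norm_num; exact exp_seven_ge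
      calc (2 : ℝ) ^ (10 : ℕ) * Real.exp ((10 : ℕ) * L ^ (99 / 100 : ℝ))
          ≤ Real.exp 7 * Real.exp ((10 : ℕ) * L ^ (99 / 100 : ℝ)) :=
            mul_le_mul_of_nonneg_right h1024 (Real.exp_nonneg _)
        _ = Real.exp (7 + 10 * L ^ (99 / 100 : ℝ)) := by rw [← Real.exp_add]; norm_num
        _ ≤ Real.exp (L / 2) := Real.exp_le_exp.2 (by nlinarith)
    have h3 : Real.exp (L / 2) * (1 / Real.exp L) = Real.exp (-(L / 2)) := by
      rw [one_div, ← Real.exp_neg, ← Real.exp_add]; ring_nf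
    have h4 : Real.exp (-(L / 2)) ≤ Real.exp (-(L ^ (1 / 100 : ℝ) / 6)) := Real.exp_le_exp.2 (by linarith)
    calc (Real.exp (L ^ (99 / 100 : ℝ)) + 1) ^ (10 : ℕ) * (1 / Real.exp L)
        ≤ Real.exp (L / 2) * (1 / Real.exp L) := mul_le_mul_of_nonneg_right (h1.trans h2) (by positivity)
      _ ≤ L ^ (-(1 / 50) : ℝ) := by rw [h3]; exact h4.trans hsmall
  rw [hratio, add_mul]
  have hmain : (Real.exp L + 1) * (Real.exp (6 / L ^ (97 / 100 : ℝ)) * L ^ (-(1 / 50) : ℝ)) * (1 / Real.exp L) ≤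
      2 * Real.exp 6 * L ^ (-(1 / 50) : ℝ) := by
    have h0 : 0 ≤ L ^ (-(1 / 50) : ℝ) := Real.rpow_nonneg hL0.le _
    calc (Real.exp L + 1) * (Real.exp (6 / L ^ (97 / 100 : ℝ)) * L ^ (-(1 / 50) : ℝ)) * (1 / Real.exp L)
        = ((Real.exp L + 1) * (1 / Real.exp L)) * (Real.exp (6 / L ^ (97 / 100 : ℝ)) * L ^ (-(1 / 50) : ℝ)) := by
          ring
      _ ≤ 2 * (Real.exp 6 * L ^ (-(1 / 50) : ℝ)) :=
          mul_le_mul hX1 (mul_le_mul_of_nonneg_right he6 h0) (by positivity) (by norm_num)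
      _ = 2 * Real.exp 6 * L ^ (-(1 / 50) : ℝ) := by ring
  linarith

end MatomakiRadziwillU

namespace SieveIntervalSystem

variable {η X : ℝ} (I : SieveIntervalSystem η X)

set_option maxHeartbeats 400000 in
/-- **§8.3: the bound for `∫_𝒰 |F(1+it)|² dt`** ("Combining the above estimates, we get the bound
`∫_𝒰 |F(1+it)|² dt ≪ H (log X)² (log X)^{-1/8+o(1)} (log Q)²/(log P)⁴ + (T/X + 1)(1/H + log P/log Q)
≪ (T/X + 1)(log X)^{-1/48+o(1)}`"), in the explicit form: for `0 < η < 1/6`, `f` multiplicative with `|f| ≤ 1`,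
`X` satisfying the size conditions `c2`–`c7` on `L = log X`, `X^{1/4} ≤ T ≤ X` and `H₁ ≥ 2`,
`∫_𝒰 |F(1+it)|² dt ≤ (T/X + 1) · 20000 (2 + K(2e⁶+1)) L^{-1/50} + 160000 C₉ (4 + 4^20 C₈) L^{-1/50}
  + 17280000 C₃² C₁₁ C (1+C₈) 4^J L^{-1/40}`,
where `𝒰 ⊂ [(log X)^{1/15}, T]`, the parameters are `H = L^{1/50}`, `P = exp(L^{97/100})`, `Q = exp(L^{99/100})`,
and `C₃, C₈, C₉, C₁₁, C, K` are the constants of Lemmas 3, 8, 9, 11, Brun–Titchmarsh and the sieve bound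
`card_Icc_filter_forall_not_dvd_le` (the factor `4^J`, "`2^J ≪ (log X)^{o(1)}`", is removed in the final
assembly). [cite: MatomakiRadziwillAnnals2016, §8.3] -/
theorem integral_Uset_bound {C₃ C₈ C₉ C₁₁ C K : ℝ} (hC₃ : 0 ≤ C₃) (h3 : (∀ f : ArithmeticFunction ℝ, f.IsMultiplicative → (∀ n, |f n| ≤ 1) →
      ∀ X P Q t : ℝ, 2 ≤ P → P ≤ Q → Q ≤ X → Real.log X ^ (1 / 16 : ℝ) ≤ t → t ≤ X ^ (2 : ℝ) →
        ‖∑ n ∈ Finset.Icc ⌈X⌉₊ ⌊2 * X⌋₊,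
            (f n : ℂ) * (n : ℂ) ^ (-(1 + (t : ℂ) * Complex.I)) / ((primeDivisorsIn P Q n : ℂ) + 1)‖ ≤
          C₃ * (Real.log Q / (Real.log X ^ (1 / 16 : ℝ) * Real.log P)
            + Real.log X * Real.exp (-(Real.log X / (3 * Real.log Q)) * Real.log (Real.log X / Real.log Q))))) (hC₈ : 0 ≤ C₈)
    (h8 : (∀ (P T V : ℝ) (a : ℕ → ℂ) (𝒯 : Finset ℝ), 2 ≤ P → P ^ 2 ≤ T →
      Real.exp (Real.exp 4) ≤ T → 1 ≤ V → (∀ p, ‖a p‖ ≤ 1) → (∀ t ∈ 𝒯, |t| ≤ T) →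
      (∀ t ∈ 𝒯, ∀ t' ∈ 𝒯, t ≠ t' → 1 ≤ |t - t'|) →
      (∀ t ∈ 𝒯, V⁻¹ ≤ ‖∑ p ∈ (Finset.Icc ⌈P⌉₊ ⌊2 * P⌋₊).filter Nat.Prime,
          a p * (p : ℂ) ^ (-(1 + (t : ℂ) * Complex.I))‖) →
      ((Finset.card 𝒯 : ℕ) : ℝ) ≤ C₈ * V ^ 2 * T ^ (2 * Real.log V / Real.log P)
        * Real.exp (4 * (Real.log T / Real.log P) * Real.log (Real.log T)))) (hC₉ : 0 ≤ C₉) (h9 : (∀ (N : ℕ) (a : ℕ → ℂ) (T : ℝ) (𝒯 : Finset ℝ), 1 ≤ N → 1 ≤ T →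
      (∀ t ∈ 𝒯, |t| ≤ T) → (∀ t ∈ 𝒯, ∀ t' ∈ 𝒯, t ≠ t' → 1 ≤ |t - t'|) →
      ∑ t ∈ 𝒯, ‖∑ n ∈ Finset.Icc 1 N, a n * (n : ℂ) ^ (-((t : ℂ) * Complex.I))‖ ^ 2 ≤
        C₉ * (N + (Finset.card 𝒯 : ℕ) * Real.sqrt T) * Real.log (2 * T) * ∑ n ∈ Finset.Icc 1 N, ‖a n‖ ^ 2)) (hC₁₁ : 0 ≤ C₁₁) (h11 : (∀ (P T : ℝ) (a : ℕ → ℂ) (𝒯 : Finset ℝ), 2 ≤ P → 2 ≤ T →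
      (∀ t ∈ 𝒯, |t| ≤ T) → (∀ t ∈ 𝒯, ∀ t' ∈ 𝒯, t ≠ t' → 1 ≤ |t - t'|) →
      ∑ t ∈ 𝒯, ‖∑ p ∈ (Finset.Icc ⌈P⌉₊ ⌊2 * P⌋₊).filter Nat.Prime,
          a p * (p : ℂ) ^ (-((t : ℂ) * Complex.I))‖ ^ 2 ≤
        C₁₁ * (P + ((Finset.card 𝒯 : ℕ) : ℝ) * P * Real.exp (-(Real.log P / Real.log T ^ (2 / 3 + 1 / 10 : ℝ)))
            * Real.log T ^ 2)
          * ∑ p ∈ (Finset.Icc ⌈P⌉₊ ⌊2 * P⌋₊).filter Nat.Prime, ‖a p‖ ^ 2 / Real.log P))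
    (hC : 0 ≤ C) (hBT : ∀ N M : ℕ, 2 ≤ M → (#((Ioc N (N + M)).filter Nat.Prime) : ℝ) ≤ C * M / Real.log M)
    (hK0 : 0 ≤ K) (hK : ∀ X P' Q' : ℝ, 1 ≤ X → 2 ≤ P' → P' ≤ Q' →
      (#((Icc ⌈X⌉₊ ⌊2 * X⌋₊).filter
          (fun n : ℕ => ∀ p ∈ (Icc ⌈P'⌉₊ ⌊Q'⌋₊).filter Nat.Prime, ¬ p ∣ n)) : ℝ) ≤
        K * ((X + 1) * (Real.exp (6 / Real.log P') * (Real.log P' / Real.log Q')) + (Q' + 1) ^ (10 : ℕ)))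
    (hη : 0 < η) (hη6 : η < 1 / 6) (f : ArithmeticFunction ℝ) (hf : f.IsMultiplicative) (hf1 : ∀ n, |f n| ≤ 1)
    (hXe : Real.exp 1 ≤ X) (c2 : 2 ≤ Real.log X ^ (1 / 50 : ℝ)) (c3 : 40 * Real.log X ^ (99 / 100 : ℝ) ≤ Real.log X)
    (c4 : Real.log X ^ (1 / 14 : ℝ) * Real.sqrt (Real.log X) *
      Real.exp (2 / 3 * Real.sqrt (Real.log X) + Real.log X ^ (99 / 100 : ℝ) - 2 * η * Real.log X) ≤ 1)
    (c5 : Real.log X * Real.exp (-(Real.log X ^ (1 / 100 : ℝ) / 6)) ≤ Real.log X ^ (1 / 50 - 1 / 16 : ℝ))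
    (c6 : Real.log X ^ 202 * Real.exp (408 * Real.log X ^ (3 / 100 : ℝ) * Real.log (Real.log X)
      - Real.log X ^ (61 / 300 : ℝ) / 2) ≤ 1)
    (c7 : 4 * Real.log X ≤ Real.exp (Real.log X ^ (97 / 100 : ℝ) / 2))
    {T : ℝ} (hXT : X ^ (1 / 4 : ℝ) ≤ T) (hTX : T ≤ X) (hH1 : 2 ≤ I.Hpar 1) :
    ∫ t in I.Uset (fun p => ((f p : ℝ) : ℂ)) (Real.log X ^ (1 / 15 : ℝ)) T,
        ‖∑ n ∈ (Icc ⌈X⌉₊ ⌊2 * X⌋₊).filter I.Mem, (f n : ℂ) * (n : ℂ) ^ (-(1 + (t : ℂ) * Complex.I))‖ ^ 2 ≤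
      (T / X + 1) * (20000 * (2 + K * (2 * Real.exp 6 + 1))) * Real.log X ^ (-(1 / 50) : ℝ) +
        160000 * C₉ * (4 + 4 ^ 20 * C₈) * Real.log X ^ (-(1 / 50) : ℝ) +
        17280000 * C₃ ^ 2 * C₁₁ * C * (1 + C₈) * 4 ^ I.J * Real.log X ^ (-(1 / 40) : ℝ) := by
  classical
  have hη' : η ≤ 8 := by linarith
  have hX0 : 0 < X := (Real.exp_pos 1).trans_le hXe
  have hL1 : 1 ≤ Real.log X := by rw [← Real.log_exp 1]; exact Real.log_le_log (Real.exp_pos 1) hXe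
  have hL0 : 0 < Real.log X := by linarith
  obtain ⟨hL400, h40, hL99, hL97, h97, h9799⟩ := MatomakiRadziwillU.Lfacts hL1 c2 c3
  have hX1 : 1 ≤ X := by have := Real.add_one_le_exp (1 : ℝ); linarith
  have hXexp : X = Real.exp (Real.log X) := (Real.exp_log hX0).symm
  have hT₀ : 0 ≤ Real.log X ^ (1 / 15 : ℝ) := Real.rpow_nonneg hL0.le _
  have hXrpow : X ^ (1 / 4 : ℝ) = Real.exp (Real.log X * (1 / 4)) := Real.rpow_def_of_pos hX0 _
  have hT1 : 1 ≤ T := by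
    rw [hXrpow] at hXT
    have := Real.add_one_le_exp (Real.log X * (1 / 4)); nlinarith
  -- the parameters
  have hH1' : 1 ≤ Real.log X ^ (1 / 50 : ℝ) := by linarith
  have hP1 : 1 ≤ Real.exp (Real.log X ^ (97 / 100 : ℝ)) := Real.one_le_exp (by positivity)
  have hP2 : 2 ≤ Real.exp (Real.log X ^ (97 / 100 : ℝ)) := by
    have := Real.add_one_le_exp (Real.log X ^ (97 / 100 : ℝ)); linarith
  have hPQ : Real.exp (Real.log X ^ (97 / 100 : ℝ)) ≤ Real.exp (Real.log X ^ (99 / 100 : ℝ)) :=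
    Real.exp_le_exp.2 h9799
  have hJP : I.Q I.J < Real.exp (Real.log X ^ (97 / 100 : ℝ)) := by
    refine I.Q_J_le.trans_lt (Real.exp_lt_exp.2 ?_)
    rw [Real.sqrt_eq_rpow]
    exact Real.rpow_lt_rpow_of_exponent_lt (by linarith) (by norm_num)
  -- Lemma 12 on `𝒰`
  have h12 := I.integral_Uset_le_lemma12 hη hη' f hf hf1 hX1 hT₀ hT1 hP1 hPQ hH1' hJP
  refine h12.trans ?_
  -- the main term
  have hblocks := I.sum_blocks_integral_le hC₃ h3 hC₈ h8 hC₉ h9 hC₁₁ h11 hC hBT hη hη6 f hf hf1 hXe c2 c3 c4 c5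
    c6 c7 hXT hTX hH1
  have hA0 : 0 ≤ Real.log X ^ (1 / 50 : ℝ) *
      Real.log (Real.exp (Real.log X ^ (99 / 100 : ℝ)) / Real.exp (Real.log X ^ (97 / 100 : ℝ))) := by
    refine mul_nonneg (by linarith) (Real.log_nonneg ?_)
    rwa [one_le_div (Real.exp_pos _)]
  have hA : Real.log X ^ (1 / 50 : ℝ) *
      Real.log (Real.exp (Real.log X ^ (99 / 100 : ℝ)) / Real.exp (Real.log X ^ (97 / 100 : ℝ))) ≤
      Real.log X ^ (101 / 100 : ℝ) := by
    rw [Real.log_div (Real.exp_pos _).ne' (Real.exp_pos _).ne', Real.log_exp, Real.log_exp,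
      show (101 / 100 : ℝ) = 1 / 50 + 99 / 100 by norm_num, Real.rpow_add hL0]
    refine mul_le_mul_of_nonneg_left ?_ (by linarith)
    linarith [Real.rpow_nonneg hL0.le (97 / 100 : ℝ)]
  have hNU := MatomakiRadziwillLemma12.card_blocks_le (H := Real.log X ^ (1 / 50 : ℝ)) (by linarith) hP1 hPQ
  have hL2 : 2 ≤ Real.log X ^ (101 / 100 : ℝ) :=
    c2.trans (Real.rpow_le_rpow_of_exponent_le hL1 (by norm_num))
  have hmain := MatomakiRadziwillU.main_numeric (J := I.J) hL1 hL2 hC₈ hC₉ hC₁₁ hC hA0 hA hNU hblocks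
  -- the remainder
  obtain ⟨hrem1, hrem2⟩ := MatomakiRadziwillU.remainder_numeric hXexp hL1 c2 c3 c5
  have hS := (I.coprime_sum_le_card_div hf1 hX0 (Real.exp (Real.log X ^ (97 / 100 : ℝ)))
    (Real.exp (Real.log X ^ (99 / 100 : ℝ)))).trans
    (mul_le_mul_of_nonneg_right (hK X _ _ hX1 hP2 hPQ) (by positivity))
  rw [mul_assoc K] at hS
  have hS' := hS.trans (mul_le_mul_of_nonneg_left hrem2 hK0)
  have hTX0 : 0 ≤ (T + X) / X := by positivity
  have hrem : (T + X) / X * (1 / Real.log X ^ (1 / 50 : ℝ) + 1 / Real.exp (Real.log X ^ (97 / 100 : ℝ)) +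
      ∑ n ∈ (Icc ⌈X⌉₊ ⌊2 * X⌋₊).filter (fun n : ℕ => ∀ p ∈ (Icc ⌈Real.exp (Real.log X ^ (97 / 100 : ℝ))⌉₊
        ⌊Real.exp (Real.log X ^ (99 / 100 : ℝ))⌋₊).filter Nat.Prime, ¬ p ∣ n), ‖I.aCoef f n‖ ^ 2 / n) ≤
      (T / X + 1) * ((2 + K * (2 * Real.exp 6 + 1)) * Real.log X ^ (-(1 / 50) : ℝ)) := by
    have : (T + X) / X = T / X + 1 := by field_simp
    rw [← this]
    refine mul_le_mul_of_nonneg_left ?_ hTX0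
    linarith only [hrem1, hS']
  -- combine
  linarith only [hmain, hrem]

end SieveIntervalSystem

end Literature.NumberTheory.Sieve
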